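import Literature.NumberTheory.LFunctions.RudnickSarnakNPatterns
import Mathlib.Data.Fintype.Perm
import HarnessLib

/-!
# Rudnick–Sarnak `n`-level correlations for `ζ`, XII: the main term of the diagonal

Sibling file of `Literature/NumberTheory/LFunctions/RudnickSarnak.lean` (toward
`Literature.NumberTheory.LFunctions.rudnick_sarnak_unrestricted` at every level). The diagonal sum
`𝔖_S(ξ)` of `RudnickSarnakNPatterns.lean` is expanded over configurations of prime powers
(`RudnickSarnakNExchange.lean`) and split with `RudnickSarnakNDiagonal.lean` (Rudnick–Sarnak 1996,
Lemmas 3.7–3.10): on the sign cell `{j ∈ S : ξ_j ≤ 0} = P`, `Q = S ∖ P`,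

  `𝔖_S(ξ) = Σ_{β : P ≃ Q} Π_{j∈P} 𝒫_T(b_j, b_{β j}) + (rest)`,
  `𝒫_T(x, y) = Σ_{p ≤ N_T prime} c_x(p) c_y(p)`   (`RudnickSarnakN.pairMain`, `RudnickSarnakN.primePair`),

("the main term will be contributed by the permutations of distinct prime factors", Lemma 3.10 /
(3.65)), where the rest — improper prime powers, repeated primes, and the re-inserted coincident
tuples — is bounded by a nonnegative majorant whose integral against the density factors over the
slice is `O(L^{−k} · L^{|S|−1})` (`RudnickSarnakN.integral_densities_mul_wgt_le`: every slot but one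
is integrated in its own variable and gains `1/L`, `RudnickSarnakNExchange.lean`). Integrated
against a bounded `Φ` supported in the box `|ξ_j| ≤ 2` this gives
(`RudnickSarnakN.norm_integral_patternSum_sub_main_le`, `RudnickSarnakN.norm_integral_patternSum_le`)

  `∫_η Φ(ξ) 𝔓_T(ξ) dη = Σ_{D} Σ_{P ⊆ Dᶜ} (−1)^{|Dᶜ|} I_{|D|}(T) ∫_η Φ(ξ) Π_{j∈D} g₀(b_j) 1_{cell} Σ_β Π 𝒫_T dη + O(‖Φ‖_∞ T)`,
  `|∫_η Φ(ξ) 𝔓_T(ξ) dη| ≤ C ‖Φ‖_∞ T log T`.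

## References

* Z. Rudnick, P. Sarnak, *Zeros of principal `L`-functions and random matrix theory*, Duke Math.
  J. 81 (1996), 269–322, Lemmas 3.7–3.10, (3.65).
-/

noncomputable section

open Complex Filter Set MeasureTheory Finset
open ArithmeticFunction (vonMangoldt_nonneg)
open scoped Real Topology ArithmeticFunction.vonMangoldt

namespace Literature.NumberTheory.LFunctions

namespace RudnickSarnakN

variable {k : ℕ}

/-! ## The prime pair sums and the main term -/

/-- The common prime bound `N_T = N_{2L}`. [folklore] -/
def primeBound (T : ℝ) : ℕ := suppBound (2 * Real.log T)

/-- **The prime pair sum** `𝒫_T(x, y) = Σ_{p ≤ N_T prime} c_x(p) c_y(p) = Σ_p (log²p/p) g₀(log p − x) g₀(log p − y)`.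
(Rudnick–Sarnak 1996, (3.65)–(3.66).) [cite: RudnickSarnak1996, (3.65)] -/
def primePair (T x y : ℝ) : ℝ :=
  ∑ m ∈ Finset.Icc 1 (primeBound T), if m.Prime then coefR x m * coefR y m else 0

/-- `𝒫_T ≥ 0`. [folklore] -/
theorem primePair_nonneg (T x y : ℝ) : 0 ≤ primePair T x y :=
  Finset.sum_nonneg fun m _ ↦ by
    by_cases h : m.Prime
    · rw [if_pos h]; exact mul_nonneg (coefR_nonneg _ _) (coefR_nonneg _ _)
    · rw [if_neg h]

/-- **The main term on a sign cell**: for disjoint sets `P` (slots with `ξ_j ≤ 0`) and `Q` (slots with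
`ξ_j > 0`) and frequencies `b`, `Σ_{β : P ≃ Q} Π_{j ∈ P} 𝒫_T(b_j, b_{β j})` (zero unless `|P| = |Q|`).
(Rudnick–Sarnak 1996, Lemma 3.10: the permutations `σ ∈ S_r`.) [cite: RudnickSarnak1996, Lemma 3.10] -/
def pairMain (T : ℝ) (b : Fin (k + 1) → ℝ) (P Q : Finset (Fin (k + 1))) : ℝ :=
  ∑ β : (P ≃ Q), ∏ p : P, primePair T (b p) (b (β p))

/-- `pairMain ≥ 0`. [folklore] -/
theorem pairMain_nonneg (T : ℝ) (b : Fin (k + 1) → ℝ) (P Q : Finset (Fin (k + 1))) : 0 ≤ pairMain T b P Q :=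
  Finset.sum_nonneg fun _ _ ↦ Finset.prod_nonneg fun _ _ ↦ primePair_nonneg _ _ _

/-- `pairMain = 0` unless `|P| = |Q|`. [cite: RudnickSarnak1996, Lemma 3.10] -/
theorem pairMain_eq_zero_of_card_ne (T : ℝ) (b : Fin (k + 1) → ℝ) {P Q : Finset (Fin (k + 1))}
    (h : P.card ≠ Q.card) : pairMain T b P Q = 0 := by
  haveI : IsEmpty (P ≃ Q) := ⟨fun β ↦ h (by simpa using Fintype.card_congr β)⟩
  unfold pairMain
  exact Fintype.sum_empty _

/-! ## Configuration weights for enumerated sides -/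

/-- The weight of a configuration `(ν; μ)` for sides enumerated by `eP : Fin r → slots`, `eQ : Fin s → slots`:
`W_b(ν; μ) = Π_i c_{b(eP i)}(ν_i) · Π_j c_{b(eQ j)}(μ_j)` (`≥ 0`). [cite: RudnickSarnak1996, (3.33)] -/
def wgt (b : Fin (k + 1) → ℝ) {r s : ℕ} (eP : Fin r → Fin (k + 1)) (eQ : Fin s → Fin (k + 1))
    (ν : Fin r → ℕ) (μ : Fin s → ℕ) : ℝ :=
  (∏ i, coefR (b (eP i)) (ν i)) * ∏ j, coefR (b (eQ j)) (μ j)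

/-- `W ≥ 0`. [folklore] -/
theorem wgt_nonneg (b : Fin (k + 1) → ℝ) {r s : ℕ} (eP : Fin r → Fin (k + 1)) (eQ : Fin s → Fin (k + 1))
    (ν : Fin r → ℕ) (μ : Fin s → ℕ) : 0 ≤ wgt b eP eQ ν μ :=
  mul_nonneg (Finset.prod_nonneg fun _ _ ↦ coefR_nonneg _ _) (Finset.prod_nonneg fun _ _ ↦ coefR_nonneg _ _)

/-- `W ≤ (∫φ)^{r+s} w` with `w` the configuration weight of `RudnickSarnakNDiagonal.lean`. [folklore] -/
theorem wgt_le (b : Fin (k + 1) → ℝ) {r s : ℕ} (eP : Fin r → Fin (k + 1)) (eQ : Fin s → Fin (k + 1))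
    (ν : Fin r → ℕ) (μ : Fin s → ℕ) : wgt b eP eQ ν μ ≤ bumpMass ^ (r + s) * cfgWeight ν μ := by
  unfold wgt cfgWeight
  rw [pow_add, mul_mul_mul_comm]
  have h1 : ∀ {m : ℕ} (e : Fin m → Fin (k + 1)) (τ : Fin m → ℕ),
      ∏ i, coefR (b (e i)) (τ i) ≤ bumpMass ^ m * ∏ i, (Λ (τ i) : ℝ) / Real.sqrt (τ i) := by
    intro m e τ
    rw [show bumpMass ^ m = ∏ _i : Fin m, bumpMass by simp, ← Finset.prod_mul_distrib]
    exact Finset.prod_le_prod (fun i _ ↦ coefR_nonneg _ _) fun i _ ↦ coefR_le _ _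
  exact mul_le_mul (h1 eP ν) (h1 eQ μ) (Finset.prod_nonneg fun _ _ ↦ coefR_nonneg _ _) (by
    have := bumpMass_pos; positivity)

/-! ## Expanding the diagonal sum over configurations -/

/-- Reindexing the coefficient product by an enumeration of the side. [folklore] -/
theorem coefProd_eq_prod_equiv (b : Fin (k + 1) → ℝ) (P : Finset (Fin (k + 1))) {r : ℕ} (eP : Fin r ≃ P) :
    coefProd P b = ∏ i : Fin r, coefAF (b (eP i)) := by
  classical
  unfold coefProd
  rw [← Finset.prod_coe_sort P]
  exact (Fintype.prod_equiv eP (fun i ↦ coefAF (b (eP i))) (fun p ↦ coefAF (b p)) fun _ ↦ rfl).symm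

/-- The coefficient product as a sum over multiplicative tuples. [cite: RudnickSarnak1996, (3.33)] -/
theorem coefProd_apply_eq_sum (b : Fin (k + 1) → ℝ) (P : Finset (Fin (k + 1))) {r : ℕ} (eP : Fin r ≃ P) (M : ℕ) :
    coefProd P b M = ∑ ν ∈ Nat.finMulAntidiag r M, ∏ i, coefR (b (eP i)) (ν i) := by
  rw [coefProd_eq_prod_equiv b P eP, ArithmeticFunction.prod_apply_eq_sum_finMulAntidiag]
  rfl

/-- `1 ≤ N_T` for `T ≥ 1`. [folklore] -/
theorem one_le_primeBound {T : ℝ} (hT : 1 ≤ T) : 1 ≤ primeBound T :=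
  one_le_suppBound (by have := Real.log_nonneg hT; positivity)

/-- **The diagonal sum over configurations**: for sides `P`, `Q` enumerated by `eP`, `eQ` and
frequencies `0 ≤ b_j ≤ 2L` (`T ≥ 1`, `r ≤ n`),
`Σ_{M ≤ N_Tⁿ} (Π^* c)(M) (Π^* c)(M) = Σ_{ν ∈ [1,N_T]^r} Σ_{μ ∈ [1,N_T]^s} [Πν = Πμ] W_b(ν; μ)`.
[cite: RudnickSarnak1996, (3.33)] -/
theorem sum_coefProd_mul_eq {T : ℝ} (hT : 1 ≤ T) (b : Fin (k + 1) → ℝ) (hb : ∀ j, b j ≤ 2 * Real.log T)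
    (P Q : Finset (Fin (k + 1))) {r s : ℕ} (hr : r ≤ k + 1) (eP : Fin r ≃ P) (eQ : Fin s ≃ Q) :
    ∑ M ∈ Finset.Icc 1 (lenBound k T), coefProd P b M * coefProd Q b M =
      ∑ ν ∈ tuples r (primeBound T), ∑ μ ∈ tuples s (primeBound T),
        (if ∏ i, ν i = ∏ j, μ j then wgt b (fun i ↦ (eP i : Fin (k + 1))) (fun j ↦ (eQ j : Fin (k + 1))) ν μ else 0) := by
  have hB : primeBound T ^ r ≤ lenBound k T := Nat.pow_le_pow_right (one_le_primeBound hT) hr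
  have hvan : ∀ j (m : ℕ), primeBound T < m → coefR (b j) m = 0 := fun j m hm ↦
    coefR_eq_zero_of_suppBound_lt (lt_of_le_of_lt (suppBound_mono (hb j)) hm)
  simp_rw [coefProd_apply_eq_sum b P eP, coefProd_apply_eq_sum b Q eQ]
  rw [sum_Icc_sum_mul_sum_eq hB]
  · rfl
  · rintro ν ⟨i, hi⟩
    exact Finset.prod_eq_zero (Finset.mem_univ i) (hvan _ _ hi)
  · rintro μ ⟨j, hj⟩
    exact Finset.prod_eq_zero (Finset.mem_univ j) (hvan _ _ hj)

/-! ## The good configurations give the main term -/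

/-- The prime-restricted sum over tuples factorises into prime pair sums:
`Σ_{ν ∈ [1,N_T]^r, all prime} W_b(ν; ν∘σ) = Π_i 𝒫_T(b(eP i), b(eQ (σ⁻¹ i)))`. [cite: RudnickSarnak1996, (3.65)] -/
theorem sum_prime_wgt_comp_perm (T : ℝ) (b : Fin (k + 1) → ℝ) {r : ℕ} (eP eQ : Fin r → Fin (k + 1))
    (σ : Equiv.Perm (Fin r)) :
    ∑ ν ∈ tuples r (primeBound T), (if ∀ i, (ν i).Prime then wgt b eP eQ ν (ν ∘ σ) else 0) =
      ∏ i, primePair T (b (eP i)) (b (eQ (σ.symm i))) := by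
  have e1 : ∀ ν : Fin r → ℕ, wgt b eP eQ ν (ν ∘ σ) = ∏ i, (coefR (b (eP i)) (ν i) * coefR (b (eQ (σ.symm i))) (ν i)) := by
    intro ν
    unfold wgt
    rw [Fintype.prod_equiv σ (fun j ↦ coefR (b (eQ j)) ((ν ∘ σ) j)) (fun i ↦ coefR (b (eQ (σ.symm i))) (ν i))
      (fun j ↦ by simp), ← Finset.prod_mul_distrib]
  have e2 : ∀ ν : Fin r → ℕ, (if ∀ i, (ν i).Prime then wgt b eP eQ ν (ν ∘ σ) else 0) =
      ∏ i, (if (ν i).Prime then coefR (b (eP i)) (ν i) * coefR (b (eQ (σ.symm i))) (ν i) else 0) := by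
    intro ν
    rw [e1, Fintype.prod_ite_zero]
    congr
  simp_rw [e2]
  unfold tuples primePair
  exact Finset.sum_prod_piFinset (Finset.Icc 1 (primeBound T))
    (fun i m ↦ if m.Prime then coefR (b (eP i)) m * coefR (b (eQ (σ.symm i))) m else 0)

/-- The sum over permutations is the sum over bijections `P ≃ Q`. [cite: RudnickSarnak1996, Lemma 3.10] -/
theorem sum_perm_prod_primePair_eq (T : ℝ) (b : Fin (k + 1) → ℝ) (P Q : Finset (Fin (k + 1))) {r : ℕ}
    (eP : Fin r ≃ P) (eQ : Fin r ≃ Q) :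
    ∑ σ : Equiv.Perm (Fin r), ∏ i, primePair T (b (eP i)) (b (eQ (σ.symm i))) = pairMain T b P Q := by
  unfold pairMain
  set Θ : Equiv.Perm (Fin r) ≃ (P ≃ Q) := (Equiv.inv (Equiv.Perm (Fin r))).trans (Equiv.equivCongr eP eQ)
  have hΘ : ∀ (σ : Equiv.Perm (Fin r)) (i : Fin r), (Θ σ) (eP i) = eQ (σ.symm i) := by
    intro σ i
    simp only [Θ, Equiv.trans_apply, Equiv.inv_apply, Equiv.equivCongr_apply_apply, Equiv.symm_apply_apply,
      Equiv.Perm.inv_def]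
  refine Fintype.sum_equiv Θ (fun σ ↦ ∏ i, primePair T (b (eP i)) (b (eQ (σ.symm i))))
    (fun β ↦ ∏ p : P, primePair T (b p) (b (β p))) fun σ ↦ ?_
  refine Fintype.prod_equiv eP (fun i ↦ primePair T (b (eP i)) (b (eQ (σ.symm i))))
    (fun p ↦ primePair T (b p) (b ((Θ σ) p))) fun i ↦ ?_
  simp only [hΘ]

/-- The error weights: bad configurations, and (for `r = s`) all non-injective tuples paired with their
permutations (enumerating `Q` through `Fin |P|` when `|Q| = |P|`). [folklore] -/
def restWgt (T : ℝ) (b : Fin (k + 1) → ℝ) (P Q : Finset (Fin (k + 1))) : ℝ := by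
  classical
  exact if h : Q.card = P.card then
      (∑ ν ∈ tuples P.card (primeBound T), ∑ μ ∈ tuples P.card (primeBound T),
        (if ∏ i, ν i = ∏ j, μ j ∧ ¬ IsGood ν μ then
          wgt b (fun i ↦ (P.equivFin.symm i : Fin (k + 1))) (fun j ↦ ((Finset.equivFinOfCardEq h).symm j : Fin (k + 1))) ν μ
          else 0)) +
      ∑ σ : Equiv.Perm (Fin P.card), ∑ ν ∈ tuples P.card (primeBound T),
        (if ¬ Function.Injective ν then
          wgt b (fun i ↦ (P.equivFin.symm i : Fin (k + 1))) (fun j ↦ ((Finset.equivFinOfCardEq h).symm j : Fin (k + 1)))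
            ν (ν ∘ σ) else 0)
    else
      ∑ ν ∈ tuples P.card (primeBound T), ∑ μ ∈ tuples Q.card (primeBound T),
        (if ∏ i, ν i = ∏ j, μ j ∧ ¬ IsGood ν μ then
          wgt b (fun i ↦ (P.equivFin.symm i : Fin (k + 1))) (fun j ↦ (Q.equivFin.symm j : Fin (k + 1))) ν μ else 0)

/-- Splitting an indicator along a predicate. [folklore] -/
theorem ite_eq_ite_and_add (A G : Prop) [Decidable A] [Decidable G] (x : ℝ) :
    (if A then x else 0) = (if A ∧ G then x else 0) + (if A ∧ ¬ G then x else 0) := by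
  by_cases h1 : A
  · by_cases h2 : G
    · rw [if_pos h1, if_pos ⟨h1, h2⟩, if_neg (fun h ↦ h.2 h2), add_zero]
    · rw [if_pos h1, if_neg (fun h ↦ h2 h.2), if_pos ⟨h1, h2⟩, zero_add]
  · rw [if_neg h1, if_neg (fun h ↦ h1 h.1), if_neg (fun h ↦ h1 h.1), add_zero]

/-- **The diagonal sum on a sign cell is the main term up to the error weights**: for `T ≥ 1`,
`0 ≤ b_j ≤ 2L`, disjoint... sides `P`, `Q` with `|P| ≤ n`:
`|Σ_{M ≤ N_Tⁿ} (Π^*_{P} c)(M) (Π^*_{Q} c)(M) − pairMain| ≤ restWgt`. [cite: RudnickSarnak1996, Lemmas 3.7–3.10] -/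
theorem abs_sum_coefProd_mul_sub_pairMain_le {T : ℝ} (hT : 1 ≤ T) (b : Fin (k + 1) → ℝ)
    (hb : ∀ j, b j ≤ 2 * Real.log T) (P Q : Finset (Fin (k + 1))) :
    |(∑ M ∈ Finset.Icc 1 (lenBound k T), coefProd P b M * coefProd Q b M) - pairMain T b P Q| ≤ restWgt T b P Q := by
  classical
  have hr : P.card ≤ k + 1 := by have := P.card_le_univ; rwa [Fintype.card_fin] at this
  unfold restWgt
  by_cases h : Q.card = P.card
  · -- `r = s`: enumerate `Q` by `Fin r` as well
    rw [dif_pos h]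
    set eP : Fin P.card ≃ P := P.equivFin.symm
    set eQ : Fin P.card ≃ Q := (Finset.equivFinOfCardEq h).symm
    rw [sum_coefProd_mul_eq hT b hb P Q hr eP eQ]
    have hW0 : ∀ ν μ, 0 ≤ wgt b (fun i ↦ (eP i : Fin (k + 1))) (fun j ↦ (eQ j : Fin (k + 1))) ν μ := fun ν μ ↦ wgt_nonneg _ _ _ _ _
    have hsplit : ∀ ν μ : Fin P.card → ℕ, (if ∏ i, ν i = ∏ j, μ j then wgt b (fun i ↦ (eP i : Fin (k + 1))) (fun j ↦ (eQ j : Fin (k + 1))) ν μ else 0) =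
        (if ∏ i, ν i = ∏ j, μ j ∧ IsGood ν μ then wgt b (fun i ↦ (eP i : Fin (k + 1))) (fun j ↦ (eQ j : Fin (k + 1))) ν μ else 0) +
          (if ∏ i, ν i = ∏ j, μ j ∧ ¬ IsGood ν μ then wgt b (fun i ↦ (eP i : Fin (k + 1))) (fun j ↦ (eQ j : Fin (k + 1))) ν μ else 0) := fun ν μ ↦ ite_eq_ite_and_add _ _ _
    simp_rw [hsplit, Finset.sum_add_distrib]
    rw [sum_good_eq_sum_perm]
    have hgood : ∀ σ : Equiv.Perm (Fin P.card), ∑ ν ∈ tuples P.card (primeBound T),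
        (if (∀ i, (ν i).Prime) ∧ Function.Injective ν then wgt b (fun i ↦ (eP i : Fin (k + 1))) (fun j ↦ (eQ j : Fin (k + 1))) ν (ν ∘ σ) else 0) =
          (∏ i, primePair T (b (eP i)) (b (eQ (σ.symm i)))) -
            ∑ ν ∈ tuples P.card (primeBound T), (if (∀ i, (ν i).Prime) ∧ ¬ Function.Injective ν then wgt b (fun i ↦ (eP i : Fin (k + 1))) (fun j ↦ (eQ j : Fin (k + 1))) ν (ν ∘ σ) else 0) := by
      intro σ
      have hpr := sum_prime_wgt_comp_perm T b (fun i ↦ (eP i : Fin (k + 1))) (fun j ↦ (eQ j : Fin (k + 1))) σ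
      rw [← hpr, ← Finset.sum_sub_distrib]
      refine Finset.sum_congr rfl fun ν _ ↦ ?_
      rw [ite_eq_ite_and_add (∀ i, (ν i).Prime) (Function.Injective ν)]
      ring
    simp_rw [hgood]
    rw [Finset.sum_sub_distrib, sum_perm_prod_primePair_eq]
    set BAD := ∑ ν ∈ tuples P.card (primeBound T), ∑ μ ∈ tuples P.card (primeBound T), (if ∏ i, ν i = ∏ j, μ j ∧ ¬ IsGood ν μ then wgt b (fun i ↦ (eP i : Fin (k + 1))) (fun j ↦ (eQ j : Fin (k + 1))) ν μ else 0)
    set C1 := ∑ σ : Equiv.Perm (Fin P.card), ∑ ν ∈ tuples P.card (primeBound T),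
      (if (∀ i, (ν i).Prime) ∧ ¬ Function.Injective ν then wgt b (fun i ↦ (eP i : Fin (k + 1))) (fun j ↦ (eQ j : Fin (k + 1))) ν (ν ∘ σ) else 0)
    set C2 := ∑ σ : Equiv.Perm (Fin P.card), ∑ ν ∈ tuples P.card (primeBound T), (if ¬ Function.Injective ν then wgt b (fun i ↦ (eP i : Fin (k + 1))) (fun j ↦ (eQ j : Fin (k + 1))) ν (ν ∘ σ) else 0)
    have hBAD0 : 0 ≤ BAD := Finset.sum_nonneg fun ν _ ↦ Finset.sum_nonneg fun μ _ ↦ by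
      by_cases hc : ∏ i, ν i = ∏ j, μ j ∧ ¬ IsGood ν μ
      · rw [if_pos hc]; exact hW0 _ _
      · rw [if_neg hc]
    have hC10 : 0 ≤ C1 := Finset.sum_nonneg fun σ _ ↦ Finset.sum_nonneg fun ν _ ↦ by
      by_cases hc : (∀ i, (ν i).Prime) ∧ ¬ Function.Injective ν
      · rw [if_pos hc]; exact hW0 _ _
      · rw [if_neg hc]
    have hC12 : C1 ≤ C2 := Finset.sum_le_sum fun σ _ ↦ Finset.sum_le_sum fun ν _ ↦ by
      by_cases h2 : Function.Injective ν
      · rw [if_neg (fun h ↦ h.2 h2), if_neg (not_not_intro h2)]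
      · by_cases h1 : ∀ i, (ν i).Prime
        · rw [if_pos ⟨h1, h2⟩, if_pos h2]
        · rw [if_neg (fun h ↦ h1 h.1), if_pos h2]; exact hW0 _ _
    calc |pairMain T b P Q - C1 + BAD - pairMain T b P Q| = |BAD - C1| := by ring_nf
      _ ≤ |BAD| + |C1| := abs_sub _ _
      _ = BAD + C1 := by rw [abs_of_nonneg hBAD0, abs_of_nonneg hC10]
      _ ≤ BAD + C2 := by linarith
  · -- `r ≠ s`: no good configurations, no main term
    rw [dif_neg h]
    set eP : Fin P.card ≃ P := P.equivFin.symm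
    set eQ : Fin Q.card ≃ Q := Q.equivFin.symm
    rw [sum_coefProd_mul_eq hT b hb P Q hr eP eQ, pairMain_eq_zero_of_card_ne T b (Ne.symm h), sub_zero]
    have hW0 : ∀ ν μ, 0 ≤ wgt b (fun i ↦ (eP i : Fin (k + 1))) (fun j ↦ (eQ j : Fin (k + 1))) ν μ := fun ν μ ↦ wgt_nonneg _ _ _ _ _
    have hsplit : ∀ (ν : Fin P.card → ℕ) (μ : Fin Q.card → ℕ), (if ∏ i, ν i = ∏ j, μ j then wgt b (fun i ↦ (eP i : Fin (k + 1))) (fun j ↦ (eQ j : Fin (k + 1))) ν μ else 0) =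
        (if ∏ i, ν i = ∏ j, μ j ∧ IsGood ν μ then wgt b (fun i ↦ (eP i : Fin (k + 1))) (fun j ↦ (eQ j : Fin (k + 1))) ν μ else 0) +
          (if ∏ i, ν i = ∏ j, μ j ∧ ¬ IsGood ν μ then wgt b (fun i ↦ (eP i : Fin (k + 1))) (fun j ↦ (eQ j : Fin (k + 1))) ν μ else 0) := fun ν μ ↦ ite_eq_ite_and_add _ _ _
    simp_rw [hsplit, Finset.sum_add_distrib]
    rw [sum_good_eq_zero_of_ne (Ne.symm h), zero_add, abs_of_nonneg]
    exact Finset.sum_nonneg fun ν _ ↦ Finset.sum_nonneg fun μ _ ↦ by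
      by_cases hc : ∏ i, ν i = ∏ j, μ j ∧ ¬ IsGood ν μ
      · rw [if_pos hc]; exact hW0 _ _
      · rw [if_neg hc]

/-! ## Integrating a configuration weight against the density factors over the slice -/

/-- `1 ≤ log T` for `T ≥ 3`. [folklore] -/
theorem one_le_log {T : ℝ} (hT : 3 ≤ T) : 1 ≤ Real.log T := by
  rw [Real.le_log_iff_exp_le (by linarith)]
  linarith [Real.exp_one_lt_d9]

/-- Integrability over the slice of a product of nonnegative continuous slot functions, all but the
dependent slot integrable and the dependent slot bounded. [folklore] -/
theorem integrable_prod_cons (h : Fin (k + 1) → ℝ → ℝ) (hc : ∀ j, Continuous (h j)) (h0 : ∀ j x, 0 ≤ h j x)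
    (hint : ∀ i : Fin k, Integrable (h i.succ)) {B : ℝ} (hB : ∀ x, h 0 x ≤ B) :
    Integrable fun η : Fin k → ℝ ↦ ∏ j, h j (slicePt η j) := by
  have hg : Integrable fun η : Fin k → ℝ ↦ B * ∏ i : Fin k, h i.succ (η i) := by
    refine Integrable.const_mul ?_ B
    have := Integrable.fintype_prod (f := fun (i : Fin k) ↦ h i.succ) (μ := fun _ ↦ (volume : Measure ℝ)) hint
    simpa [volume_pi] using this
  refine hg.mono' ?_ (Eventually.of_forall fun η ↦ ?_)
  · exact (continuous_finsetProd _ fun j _ ↦ (hc j).comp (continuous_slicePt_apply j)).aestronglyMeasurable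
  · rw [Real.norm_of_nonneg (Finset.prod_nonneg fun j _ ↦ h0 _ _), Fin.prod_univ_succ]
    simp only [slicePt, Fin.cons_zero, Fin.cons_succ]
    exact mul_le_mul_of_nonneg_right (hB _) (Finset.prod_nonneg fun i _ ↦ h0 _ _)

/-- Reindexing a product over a side by its enumeration. [folklore] -/
theorem prod_side_eq {M : Type*} [CommMonoid M] (P : Finset (Fin (k + 1))) {r : ℕ} (eP : Fin r ≃ P) (f : Fin (k + 1) → M) :
    ∏ j ∈ P, f j = ∏ i : Fin r, f (eP i) := by
  rw [← Finset.prod_coe_sort P]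
  exact (Fintype.prod_equiv eP (fun i ↦ f (eP i)) (fun p ↦ f p) fun _ ↦ rfl).symm

/-- The number attached to each Dirichlet-polynomial slot by a configuration `(ν; μ)`. [folklore] -/
def slotNum (P Q : Finset (Fin (k + 1))) {r s : ℕ} (eP : Fin r ≃ P) (eQ : Fin s ≃ Q)
    (ν : Fin r → ℕ) (μ : Fin s → ℕ) (j : Fin (k + 1)) : ℕ :=
  if hj : j ∈ P then ν (eP.symm ⟨j, hj⟩) else if hj' : j ∈ Q then μ (eQ.symm ⟨j, hj'⟩) else 1

/-- `slotNum (eP i) = ν i`. [folklore] -/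
theorem slotNum_apply_eP (P Q : Finset (Fin (k + 1))) {r s : ℕ} (eP : Fin r ≃ P) (eQ : Fin s ≃ Q)
    (ν : Fin r → ℕ) (μ : Fin s → ℕ) (i : Fin r) : slotNum P Q eP eQ ν μ (eP i) = ν i := by
  unfold slotNum
  rw [dif_pos (eP i).2]
  simp

/-- `slotNum (eQ j) = μ j` when `P`, `Q` are disjoint. [folklore] -/
theorem slotNum_apply_eQ {P Q : Finset (Fin (k + 1))} (hPQ : Disjoint P Q) {r s : ℕ} (eP : Fin r ≃ P) (eQ : Fin s ≃ Q)
    (ν : Fin r → ℕ) (μ : Fin s → ℕ) (j : Fin s) : slotNum P Q eP eQ ν μ (eQ j) = μ j := by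
  unfold slotNum
  have h1 : ((eQ j : Fin (k + 1))) ∉ P := Finset.disjoint_right.1 hPQ (eQ j).2
  rw [dif_neg h1, dif_pos (eQ j).2]
  simp

/-- **Integrating a configuration weight against the density factors** (the `1/L` gain per free slot,
`RudnickSarnakNExchange.lean`): for `T ≥ 3`, pairwise disjoint `D, P, Q` covering all slots,
`∫_η Π_{j∈D} g₀(L|ξ_j|) W_{Lξ}(ν; μ) dη ≤ (∫φ) Kᵏ L^{−k} w(ν; μ)`, `K = max(2κ(0), 1)`.
[cite: RudnickSarnak1996, (3.49)] -/
theorem integral_densities_mul_wgt_le {T : ℝ} (hT : 3 ≤ T) {D P Q : Finset (Fin (k + 1))}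
    (hDP : Disjoint D P) (hDQ : Disjoint D Q) (hPQ : Disjoint P Q) (hcov : ∀ j, j ∈ D ∨ j ∈ P ∨ j ∈ Q)
    {r s : ℕ} (eP : Fin r ≃ P) (eQ : Fin s ≃ Q) (ν : Fin r → ℕ) (μ : Fin s → ℕ) :
    ∫ η : Fin k → ℝ, (∏ j ∈ D, (g0 (freq T (slicePt η) j)).re) *
        wgt (freq T (slicePt η)) (fun i ↦ (eP i : Fin (k + 1))) (fun j ↦ (eQ j : Fin (k + 1))) ν μ ≤
      bumpMass * (max (2 * ker 0) 1) ^ k / Real.log T ^ k * cfgWeight ν μ := by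
  classical
  set L := Real.log T
  have hL1 : 1 ≤ L := one_le_log hT
  have hL : 0 < L := by linarith
  set Kx : ℝ := max (2 * ker 0) 1
  have hKx1 : 1 ≤ Kx := le_max_right _ _
  set mA := slotNum P Q eP eQ ν μ
  set w : Fin (k + 1) → ℝ := fun j ↦ (Λ (mA j) : ℝ) / Real.sqrt (mA j)
  have hw0 : ∀ j, 0 ≤ w j := fun j ↦ div_nonneg vonMangoldt_nonneg (Real.sqrt_nonneg _)
  set h : Fin (k + 1) → ℝ → ℝ := fun j x ↦ if j ∈ D then (g0 (L * |x|)).re else coefR (L * |x|) (mA j)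
  have h0 : ∀ j x, 0 ≤ h j x := fun j x ↦ by
    simp only [h]; split_ifs
    · exact g0_re_nonneg _
    · exact coefR_nonneg _ _
  have hnotD : ∀ j, j ∉ D ↔ j ∈ P ∨ j ∈ Q := fun j ↦ by
    constructor
    · intro hj; rcases hcov j with h' | h' <;> tauto
    · rintro (hj | hj) hD
      · exact Finset.disjoint_left.1 hDP hD hj
      · exact Finset.disjoint_left.1 hDQ hD hj
  have hsdiff : Finset.univ \ D = P ∪ Q := by
    ext j; simp [hnotD j]
  -- the integrand as `Π_j h_j(ξ_j)`
  have hint_eq : ∀ η : Fin k → ℝ, (∏ j ∈ D, (g0 (freq T (slicePt η) j)).re) *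
      wgt (freq T (slicePt η)) (fun i ↦ (eP i : Fin (k + 1))) (fun j ↦ (eQ j : Fin (k + 1))) ν μ =
        ∏ j, h j (slicePt η j) := by
    intro η
    set ξ := slicePt η
    rw [Finset.prod_ite, Finset.filter_mem_eq_inter, Finset.univ_inter,
      show Finset.univ.filter (fun j ↦ j ∉ D) = Finset.univ \ D by ext j; simp, hsdiff, Finset.prod_union hPQ,
      prod_side_eq P eP, prod_side_eq Q eQ]
    simp only [mA, slotNum_apply_eP, slotNum_apply_eQ hPQ]
    rfl
  simp_rw [hint_eq]
  -- apply the exchange lemma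
  have hint : ∀ i : Fin k, Integrable (h i.succ) := fun i ↦ by
    simp only [h]; split_ifs
    · exact integrable_g0_re_mul_abs hL
    · exact integrable_coefR_mul_abs hL _
  set c : Fin (k + 1) → ℝ := fun j ↦ if j ∈ D then 1 else w j
  have hc0 : ∀ j, 0 ≤ c j := fun j ↦ by simp only [c]; split_ifs <;> [norm_num; exact hw0 j]
  have hB : ∀ x, h 0 x ≤ bumpMass * c 0 := fun x ↦ by
    simp only [h, c]; split_ifs
    · rw [mul_one]; exact g0_re_le _
    · exact coefR_le _ _
  have h1 := integral_prod_cons_le h h0 hint hB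
  have hJ : ∀ i : Fin k, ∫ x, h i.succ x ≤ Kx / L * c i.succ := fun i ↦ by
    simp only [h, c]; split_ifs
    · rw [integral_g0_re_mul_abs hL, mul_one]
      refine div_le_div_of_nonneg_right ?_ hL.le
      have := ker_zero_pos
      exact le_trans (by linarith) (le_max_left _ _)
    · refine (integral_coefR_mul_abs_le hL _).trans ?_
      rw [show 2 * ker 0 / L * ((Λ (mA i.succ) : ℝ) / Real.sqrt (mA i.succ)) = 2 * ker 0 / L * w i.succ from rfl]
      exact mul_le_mul_of_nonneg_right (div_le_div_of_nonneg_right (le_max_left _ _) hL.le) (hw0 _)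
  have h2 : ∏ i : Fin k, ∫ x, h i.succ x ≤ (Kx / L) ^ k * ∏ i : Fin k, c i.succ := by
    rw [show (Kx / L) ^ k = ∏ _i : Fin k, Kx / L by rw [Finset.prod_const, Finset.card_univ, Fintype.card_fin],
      ← Finset.prod_mul_distrib]
    exact Finset.prod_le_prod (fun i _ ↦ integral_nonneg fun x ↦ h0 _ _) fun i _ ↦ hJ i
  have hcw : ∏ j, c j = cfgWeight ν μ := by
    simp only [c]
    rw [Finset.prod_ite, Finset.prod_const_one, one_mul,
      show Finset.univ.filter (fun j ↦ j ∉ D) = Finset.univ \ D by ext j; simp, hsdiff, Finset.prod_union hPQ,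
      prod_side_eq P eP, prod_side_eq Q eQ]
    simp only [w, mA, slotNum_apply_eP, slotNum_apply_eQ hPQ]
    rfl
  calc ∫ η : Fin k → ℝ, ∏ j, h j (slicePt η j) ≤ bumpMass * c 0 * ∏ i : Fin k, ∫ x, h i.succ x := h1
    _ ≤ bumpMass * c 0 * ((Kx / L) ^ k * ∏ i : Fin k, c i.succ) :=
        mul_le_mul_of_nonneg_left h2 (mul_nonneg bumpMass_pos.le (hc0 0))
    _ = bumpMass * (Kx / L) ^ k * ∏ j, c j := by rw [Fin.prod_univ_succ]; ring
    _ = bumpMass * Kx ^ k / L ^ k * cfgWeight ν μ := by rw [hcw, div_pow]; ring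

/-- Integrability of the same integrand. [folklore] -/
theorem integrable_densities_mul_wgt {T : ℝ} (hT : 3 ≤ T) {D P Q : Finset (Fin (k + 1))}
    (hDP : Disjoint D P) (hDQ : Disjoint D Q) (hPQ : Disjoint P Q) (hcov : ∀ j, j ∈ D ∨ j ∈ P ∨ j ∈ Q)
    {r s : ℕ} (eP : Fin r ≃ P) (eQ : Fin s ≃ Q) (ν : Fin r → ℕ) (μ : Fin s → ℕ) :
    Integrable fun η : Fin k → ℝ ↦ (∏ j ∈ D, (g0 (freq T (slicePt η) j)).re) *
        wgt (freq T (slicePt η)) (fun i ↦ (eP i : Fin (k + 1))) (fun j ↦ (eQ j : Fin (k + 1))) ν μ := by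
  classical
  set L := Real.log T
  have hL : 0 < L := by have := one_le_log hT; simp only [L]; linarith
  set mA := slotNum P Q eP eQ ν μ
  set h : Fin (k + 1) → ℝ → ℝ := fun j x ↦ if j ∈ D then (g0 (L * |x|)).re else coefR (L * |x|) (mA j)
  have hnotD : ∀ j, j ∉ D ↔ j ∈ P ∨ j ∈ Q := fun j ↦ by
    constructor
    · intro hj; rcases hcov j with h' | h' <;> tauto
    · rintro (hj | hj) hD
      · exact Finset.disjoint_left.1 hDP hD hj
      · exact Finset.disjoint_left.1 hDQ hD hj
  have hsdiff : Finset.univ \ D = P ∪ Q := by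
    ext j; simp [hnotD j]
  have hint_eq : (fun η : Fin k → ℝ ↦ (∏ j ∈ D, (g0 (freq T (slicePt η) j)).re) *
      wgt (freq T (slicePt η)) (fun i ↦ (eP i : Fin (k + 1))) (fun j ↦ (eQ j : Fin (k + 1))) ν μ) =
        fun η ↦ ∏ j, h j (slicePt η j) := by
    funext η
    rw [Finset.prod_ite, Finset.filter_mem_eq_inter, Finset.univ_inter,
      show Finset.univ.filter (fun j ↦ j ∉ D) = Finset.univ \ D by ext j; simp, hsdiff, Finset.prod_union hPQ,
      prod_side_eq P eP, prod_side_eq Q eQ]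
    simp only [mA, slotNum_apply_eP, slotNum_apply_eQ hPQ]
    rfl
  rw [hint_eq]
  refine integrable_prod_cons h (fun j ↦ ?_) (fun j x ↦ ?_) (fun i ↦ ?_) (B := bumpMass * (1 + (Λ (mA 0) : ℝ) / Real.sqrt (mA 0))) fun x ↦ ?_
  · simp only [h]; split_ifs
    · exact Complex.continuous_re.comp (continuous_g0.comp (continuous_const.mul continuous_abs))
    · unfold coefR
      exact continuous_const.mul (Complex.continuous_re.comp (continuous_g0.comp
        (continuous_const.sub (continuous_const.mul continuous_abs))))
  · simp only [h]; split_ifs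
    · exact g0_re_nonneg _
    · exact coefR_nonneg _ _
  · simp only [h]; split_ifs
    · exact integrable_g0_re_mul_abs hL
    · exact integrable_coefR_mul_abs hL _
  · have hw : 0 ≤ (Λ (mA 0) : ℝ) / Real.sqrt (mA 0) := div_nonneg vonMangoldt_nonneg (Real.sqrt_nonneg _)
    simp only [h]; split_ifs
    · exact (g0_re_le _).trans (by nlinarith [bumpMass_pos])
    · exact (coefR_le _ _).trans (by nlinarith [bumpMass_pos])

/-! ## Arithmetic sizes in powers of `L` -/

/-- `log N_T ≤ 3 log T` for `T ≥ 3`. [folklore] -/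
theorem log_primeBound_le {T : ℝ} (hT : 3 ≤ T) : Real.log (primeBound T) ≤ 3 * Real.log T := by
  have hL := one_le_log hT
  have h1 : (primeBound T : ℝ) ≤ Real.exp (2 * Real.log T + 1 / 4) := suppBound_le _
  have h0 : (1 : ℝ) ≤ primeBound T := by exact_mod_cast one_le_primeBound (by linarith : (1 : ℝ) ≤ T)
  calc Real.log (primeBound T) ≤ Real.log (Real.exp (2 * Real.log T + 1 / 4)) := Real.log_le_log (by linarith) h1
    _ = 2 * Real.log T + 1 / 4 := Real.log_exp _
    _ ≤ 3 * Real.log T := by linarith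

/-- `0 ≤ log N_T`. [folklore] -/
theorem log_primeBound_nonneg (T : ℝ) : 0 ≤ Real.log (primeBound T) := Real.log_natCast_nonneg _

/-- `M₁ = Σ_{n ≤ N_T} Λ(n)/n ≤ 9 log T` for `T ≥ 3`. [folklore] -/
theorem sum_vonMangoldt_div_le_nine_log {T : ℝ} (hT : 3 ≤ T) :
    ∑ n ∈ Finset.Icc 1 (primeBound T), (Λ n : ℝ) / n ≤ 9 * Real.log T := by
  have hL := one_le_log hT
  have h1 := sum_vonMangoldt_div_self_le (primeBound T)
  have h2 := log_primeBound_le hT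
  have h4 : Real.log 4 < 1.3863 := by
    have := Real.log_two_lt_d9
    rw [show (4 : ℝ) = 2 ^ 2 by norm_num, Real.log_pow]; push_cast; linarith
  linarith

/-- Powers of `L ≥ 1` are monotone in the exponent (helper). [folklore] -/
theorem log_pow_le_log_pow {T : ℝ} (hT : 3 ≤ T) {a b : ℕ} (h : a ≤ b) : Real.log T ^ a ≤ Real.log T ^ b :=
  pow_le_pow_right₀ (one_le_log hT) h

/-- One half of the bad-configuration bound in powers of `L`: for `1 ≤ r ≤ n`, `s ≤ n`,
`(r log N)^s (7r M₁^{r−1} + 3r² M₁^{r−2}) ≤ (3n)ⁿ (7n + 3n²) 9ⁿ L^{r+s−1}`. [folklore] -/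
theorem bad_half_le {T : ℝ} (hT : 3 ≤ T) {r s : ℕ} (hr : r ≤ k + 1) (hs : s ≤ k + 1) :
    (r * Real.log (primeBound T)) ^ s * (7 * r * (∑ n ∈ Finset.Icc 1 (primeBound T), (Λ n : ℝ) / n) ^ (r - 1) +
        3 * r ^ 2 * (∑ n ∈ Finset.Icc 1 (primeBound T), (Λ n : ℝ) / n) ^ (r - 2)) ≤
      (3 * (k + 1)) ^ (k + 1) * ((7 * (k + 1) + 3 * (k + 1) ^ 2) * 9 ^ (k + 1)) * Real.log T ^ (r + s - 1) := by
  set L := Real.log T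
  set N := primeBound T
  set M₁ := ∑ n ∈ Finset.Icc 1 N, (Λ n : ℝ) / n
  have hL := one_le_log hT
  have hM₁ : M₁ ≤ 9 * L := sum_vonMangoldt_div_le_nine_log hT
  have hM₁0 : 0 ≤ M₁ := sum_vonMangoldt_div_self_nonneg N
  have hlogN : Real.log N ≤ 3 * L := log_primeBound_le hT
  have hlogN0 : 0 ≤ Real.log N := log_primeBound_nonneg T
  have hrr : (r : ℝ) ≤ k + 1 := by exact_mod_cast hr
  have hn1 : (1 : ℝ) ≤ 3 * (k + 1) := by have : (0:ℝ) ≤ k := Nat.cast_nonneg k; linarith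
  rcases Nat.eq_zero_or_pos r with h0 | hrpos
  · subst h0; simp; positivity
  -- `r ≥ 1`
  have e1 : (r * Real.log N) ^ s ≤ (3 * (k + 1)) ^ (k + 1) * L ^ s := by
    calc (r * Real.log N) ^ s ≤ (3 * (k + 1) * L) ^ s := by
          refine pow_le_pow_left₀ (by positivity) ?_ _
          calc (r : ℝ) * Real.log N ≤ (k + 1) * (3 * L) := mul_le_mul hrr hlogN hlogN0 (by positivity)
            _ = 3 * (k + 1) * L := by ring
      _ = (3 * (k + 1)) ^ s * L ^ s := mul_pow _ _ _
      _ ≤ (3 * (k + 1)) ^ (k + 1) * L ^ s := mul_le_mul_of_nonneg_right (pow_le_pow_right₀ hn1 hs) (by positivity)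
  have e2 : 7 * r * M₁ ^ (r - 1) + 3 * r ^ 2 * M₁ ^ (r - 2) ≤ (7 * (k + 1) + 3 * (k + 1) ^ 2) * 9 ^ (k + 1) * L ^ (r - 1) := by
    have hM9 : ∀ m, m ≤ k + 1 → M₁ ^ m ≤ 9 ^ (k + 1) * L ^ m := fun m hm ↦ by
      calc M₁ ^ m ≤ (9 * L) ^ m := pow_le_pow_left₀ hM₁0 hM₁ m
        _ = 9 ^ m * L ^ m := mul_pow _ _ _
        _ ≤ 9 ^ (k + 1) * L ^ m := mul_le_mul_of_nonneg_right (pow_le_pow_right₀ (by norm_num) hm) (by positivity)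
    have h3 : M₁ ^ (r - 1) ≤ 9 ^ (k + 1) * L ^ (r - 1) := hM9 _ (by omega)
    have h4 : M₁ ^ (r - 2) ≤ 9 ^ (k + 1) * L ^ (r - 1) :=
      (hM9 _ (by omega)).trans (mul_le_mul_of_nonneg_left (log_pow_le_log_pow hT (by omega)) (by positivity))
    have h5 : (7 : ℝ) * r ≤ 7 * (k + 1) := by linarith
    have h6 : (3 : ℝ) * r ^ 2 ≤ 3 * (k + 1) ^ 2 := by nlinarith
    calc 7 * r * M₁ ^ (r - 1) + 3 * r ^ 2 * M₁ ^ (r - 2)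
        ≤ 7 * (k + 1) * (9 ^ (k + 1) * L ^ (r - 1)) + 3 * (k + 1) ^ 2 * (9 ^ (k + 1) * L ^ (r - 1)) :=
          add_le_add (mul_le_mul h5 h3 (by positivity) (by positivity)) (mul_le_mul h6 h4 (by positivity) (by positivity))
      _ = _ := by ring
  calc (r * Real.log N) ^ s * (7 * r * M₁ ^ (r - 1) + 3 * r ^ 2 * M₁ ^ (r - 2))
      ≤ ((3 * (k + 1)) ^ (k + 1) * L ^ s) * ((7 * (k + 1) + 3 * (k + 1) ^ 2) * 9 ^ (k + 1) * L ^ (r - 1)) :=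
        mul_le_mul e1 e2 (by positivity) (by positivity)
    _ = (3 * (k + 1)) ^ (k + 1) * ((7 * (k + 1) + 3 * (k + 1) ^ 2) * 9 ^ (k + 1)) * (L ^ s * L ^ (r - 1)) := by ring
    _ = _ := by rw [← pow_add]; congr 2; omega

/-- The constant of the bad-configuration bound. [folklore] -/
def badConst (k : ℕ) : ℝ := 2 * ((3 * (k + 1)) ^ (k + 1) * ((7 * (k + 1) + 3 * (k + 1) ^ 2) * 9 ^ (k + 1)))

open scoped Classical in
/-- **Bad configurations in powers of `L`**: `Σ_{bad, Πν=Πμ} w(ν;μ) ≤ C_bad(n) L^{r+s−1}` (`T ≥ 3`, `r, s ≤ n`).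
[cite: RudnickSarnak1996, Lemmas 3.8–3.9] -/
theorem sum_cfgWeight_bad_le_pow {T : ℝ} (hT : 3 ≤ T) {r s : ℕ} (hr : r ≤ k + 1) (hs : s ≤ k + 1) :
    ∑ ν ∈ tuples r (primeBound T), ∑ μ ∈ tuples s (primeBound T),
        (if ∏ i, ν i = ∏ j, μ j ∧ ¬ IsGood ν μ then cfgWeight ν μ else 0) ≤ badConst k * Real.log T ^ (r + s - 1) := by
  refine (sum_cfgWeight_bad_le _).trans ?_
  have h1 := bad_half_le (k := k) hT hr hs
  have h2 := bad_half_le (k := k) hT hs hr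
  rw [show s + r - 1 = r + s - 1 by omega] at h2
  unfold badConst
  linarith

/-- The constant of the coincidence bound. [folklore] -/
def coincConst (k : ℕ) : ℝ := (k + 1).factorial * ((k + 1) ^ 2 * 27 * 27 ^ (k + 1))

open scoped Classical in
/-- **Coincident prime tuples in powers of `L`**: for `2 ≤ r ≤ n`,
`Σ_σ Σ_{ν not injective} w(ν; ν∘σ) ≤ C_co(n) L^{2r−2}`. [cite: RudnickSarnak1996, Lemma 3.10] -/
theorem sum_perm_sum_not_injective_le_pow {T : ℝ} (hT : 3 ≤ T) {r : ℕ} (hr2 : 2 ≤ r) (hr : r ≤ k + 1) :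
    ∑ σ : Equiv.Perm (Fin r), ∑ ν ∈ tuples r (primeBound T),
        (if ¬ Function.Injective ν then cfgWeight ν (ν ∘ σ) else 0) ≤ coincConst k * Real.log T ^ (2 * r - 2) := by
  set L := Real.log T
  set N := primeBound T
  have hL := one_le_log hT
  have hlogN : Real.log N ≤ 3 * L := log_primeBound_le hT
  have hlogN0 : 0 ≤ Real.log N := log_primeBound_nonneg T
  have h4 : Real.log 4 < 1.3863 := by
    have := Real.log_two_lt_d9
    rw [show (4 : ℝ) = 2 ^ 2 by norm_num, Real.log_pow]; push_cast; linarith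
  have hinner : ∀ σ : Equiv.Perm (Fin r), ∑ ν ∈ tuples r N, (if ¬ Function.Injective ν then cfgWeight ν (ν ∘ σ) else 0) =
      ∑ ν ∈ (tuples r N).filter (fun ν ↦ ¬ Function.Injective ν), ∏ i, (Λ (ν i) : ℝ) ^ 2 / ν i := by
    intro σ
    rw [Finset.sum_filter]
    refine Finset.sum_congr rfl fun ν _ ↦ ?_
    split_ifs <;> first | rfl | exact cfgWeight_comp_perm ν σ
  simp_rw [hinner]
  rw [Finset.sum_const, Finset.card_univ, Fintype.card_perm, Fintype.card_fin, nsmul_eq_mul]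
  have hco := sum_prod_sq_div_not_injective_le (r := r) N
  have hfac : ((r.factorial : ℕ) : ℝ) ≤ (k + 1).factorial := by exact_mod_cast Nat.factorial_le hr
  have hrr : (r : ℝ) ≤ k + 1 := by exact_mod_cast hr
  have hX : Real.log N * (2 * Real.log N + 2 * Real.log 4) ≤ 27 * L ^ 2 := by nlinarith
  have hX0 : 0 ≤ Real.log N * (2 * Real.log N + 2 * Real.log 4) := by
    have : 0 ≤ Real.log 4 := Real.log_nonneg (by norm_num); positivity
  have hb : (r : ℝ) ^ 2 * (3 * Real.log N ^ 2) * (Real.log N * (2 * Real.log N + 2 * Real.log 4)) ^ (r - 2) ≤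
      ((k + 1) ^ 2 * 27 * 27 ^ (k + 1)) * L ^ (2 * r - 2) := by
    have e1 : (r : ℝ) ^ 2 * (3 * Real.log N ^ 2) ≤ (k + 1) ^ 2 * 27 * L ^ 2 := by
      have h9 : Real.log N ^ 2 ≤ 9 * L ^ 2 := by nlinarith
      have hr2' : (r : ℝ) ^ 2 ≤ (k + 1) ^ 2 := pow_le_pow_left₀ (Nat.cast_nonneg _) hrr 2
      calc (r : ℝ) ^ 2 * (3 * Real.log N ^ 2) ≤ (k + 1) ^ 2 * (3 * (9 * L ^ 2)) :=
            mul_le_mul hr2' (by linarith) (by positivity) (by positivity)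
        _ = (k + 1) ^ 2 * 27 * L ^ 2 := by ring
    have e2 : (Real.log N * (2 * Real.log N + 2 * Real.log 4)) ^ (r - 2) ≤ 27 ^ (k + 1) * L ^ (2 * (r - 2)) := by
      calc _ ≤ (27 * L ^ 2) ^ (r - 2) := pow_le_pow_left₀ hX0 hX _
        _ = 27 ^ (r - 2) * L ^ (2 * (r - 2)) := by rw [mul_pow, ← pow_mul]
        _ ≤ 27 ^ (k + 1) * L ^ (2 * (r - 2)) :=
            mul_le_mul_of_nonneg_right (pow_le_pow_right₀ (by norm_num) (by omega)) (by positivity)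
    calc _ ≤ ((k + 1) ^ 2 * 27 * L ^ 2) * (27 ^ (k + 1) * L ^ (2 * (r - 2))) := mul_le_mul e1 e2 (by positivity) (by positivity)
      _ = ((k + 1) ^ 2 * 27 * 27 ^ (k + 1)) * (L ^ 2 * L ^ (2 * (r - 2))) := by ring
      _ = _ := by rw [← pow_add]; congr 2; omega
  unfold coincConst
  calc ((r.factorial : ℕ) : ℝ) * ∑ ν ∈ (tuples r N).filter (fun ν ↦ ¬ Function.Injective ν), ∏ i, (Λ (ν i) : ℝ) ^ 2 / ν i
      ≤ ((k + 1).factorial : ℝ) * (((k + 1) ^ 2 * 27 * 27 ^ (k + 1)) * L ^ (2 * r - 2)) :=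
        mul_le_mul hfac (hco.trans hb) (Finset.sum_nonneg fun ν _ ↦ Finset.prod_nonneg fun _ _ ↦
          div_nonneg (sq_nonneg _) (Nat.cast_nonneg _)) (by positivity)
    _ = _ := by ring

open scoped Classical in
/-- **All configurations in powers of `L`**: `Σ_{Πν=Πμ} w(ν;μ) ≤ (3n)ⁿ 9ⁿ L^{r+s}`. [cite: RudnickSarnak1996, (3.49)] -/
theorem sum_cfgWeight_le_pow {T : ℝ} (hT : 3 ≤ T) {r s : ℕ} (hr : r ≤ k + 1) (hs : s ≤ k + 1) :
    ∑ ν ∈ tuples r (primeBound T), ∑ μ ∈ tuples s (primeBound T),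
        (if ∏ i, ν i = ∏ j, μ j then cfgWeight ν μ else 0) ≤ (3 * (k + 1)) ^ (k + 1) * 9 ^ (k + 1) * Real.log T ^ (r + s) := by
  set L := Real.log T
  set N := primeBound T
  have hL := one_le_log hT
  have hlogN : Real.log N ≤ 3 * L := log_primeBound_le hT
  have hlogN0 : 0 ≤ Real.log N := log_primeBound_nonneg T
  have h4 : Real.log 4 < 1.3863 := by
    have := Real.log_two_lt_d9
    rw [show (4 : ℝ) = 2 ^ 2 by norm_num, Real.log_pow]; push_cast; linarith
  have hrr : (r : ℝ) ≤ k + 1 := by exact_mod_cast hr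
  have hn1 : (1 : ℝ) ≤ 3 * (k + 1) := by have : (0:ℝ) ≤ k := Nat.cast_nonneg k; linarith
  refine (sum_cfgWeight_le _).trans ?_
  have e1 : (r * Real.log N) ^ s ≤ (3 * (k + 1)) ^ (k + 1) * L ^ s := by
    calc (r * Real.log N) ^ s ≤ (3 * (k + 1) * L) ^ s := by
          refine pow_le_pow_left₀ (by positivity) ?_ _
          calc (r : ℝ) * Real.log N ≤ (k + 1) * (3 * L) := mul_le_mul hrr hlogN hlogN0 (by positivity)
            _ = 3 * (k + 1) * L := by ring
      _ = (3 * (k + 1)) ^ s * L ^ s := mul_pow _ _ _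
      _ ≤ (3 * (k + 1)) ^ (k + 1) * L ^ s := mul_le_mul_of_nonneg_right (pow_le_pow_right₀ hn1 hs) (by positivity)
  have e2 : (2 * Real.log N + 2 * Real.log 4) ^ r ≤ 9 ^ (k + 1) * L ^ r := by
    have h0 : 0 ≤ 2 * Real.log N + 2 * Real.log 4 := by have : 0 ≤ Real.log 4 := Real.log_nonneg (by norm_num); positivity
    calc _ ≤ (9 * L) ^ r := pow_le_pow_left₀ h0 (by nlinarith) _
      _ = 9 ^ r * L ^ r := mul_pow _ _ _
      _ ≤ 9 ^ (k + 1) * L ^ r := mul_le_mul_of_nonneg_right (pow_le_pow_right₀ (by norm_num) hr) (by positivity)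
  calc (r * Real.log N) ^ s * (2 * Real.log N + 2 * Real.log 4) ^ r
      ≤ ((3 * (k + 1)) ^ (k + 1) * L ^ s) * (9 ^ (k + 1) * L ^ r) := mul_le_mul e1 e2 (by positivity) (by positivity)
    _ = _ := by rw [pow_add]; ring

/-- `|I_m(T)| ≤ T (log T + 4)^m` for `T ≥ 2`. [folklore] -/
theorem abs_ellInt_le {T : ℝ} (hT : 2 ≤ T) (m : ℕ) : |ellInt m T| ≤ T * (Real.log T + 4) ^ m := by
  have hT0 : (0 : ℝ) ≤ T := by linarith
  unfold ellInt
  calc |∫ t in (0 : ℝ)..T, ell t ^ m| ≤ ∫ t in (0 : ℝ)..T, |ell t ^ m| := by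
        have := intervalIntegral.norm_integral_le_integral_norm (f := fun t ↦ ell t ^ m) (μ := volume) hT0
        simpa only [Real.norm_eq_abs] using this
    _ ≤ ∫ _t in (0 : ℝ)..T, (Real.log T + 4) ^ m := by
        refine intervalIntegral.integral_mono_on hT0 ((continuous_ell.pow m).abs.intervalIntegrable _ _)
          (continuous_const.intervalIntegrable _ _) fun t ht ↦ ?_
        rw [abs_pow]
        exact abs_ell_pow_le hT ht m
    _ = T * (Real.log T + 4) ^ m := by rw [intervalIntegral.integral_const, sub_zero, smul_eq_mul]

/-- `|I_m(T)| ≤ T (5 log T)^m` for `T ≥ 3`. [folklore] -/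
theorem abs_ellInt_le' {T : ℝ} (hT : 3 ≤ T) (m : ℕ) : |ellInt m T| ≤ T * (5 * Real.log T) ^ m := by
  have hL := one_le_log hT
  refine (abs_ellInt_le (by linarith) m).trans (mul_le_mul_of_nonneg_left ?_ (by linarith))
  exact pow_le_pow_left₀ (by linarith) (by linarith) m

/-! ## The error weights integrated against the densities -/

/-- `restWgt ≥ 0`. [folklore] -/
theorem restWgt_nonneg (T : ℝ) (b : Fin (k + 1) → ℝ) (P Q : Finset (Fin (k + 1))) : 0 ≤ restWgt T b P Q := by
  classical
  unfold restWgt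
  split_ifs with h
  · refine add_nonneg (Finset.sum_nonneg fun ν _ ↦ Finset.sum_nonneg fun μ _ ↦ ?_)
      (Finset.sum_nonneg fun σ _ ↦ Finset.sum_nonneg fun ν _ ↦ ?_)
    · split_ifs
      · exact wgt_nonneg _ _ _ _ _
      · exact le_rfl
    · split_ifs
      · exact le_rfl
      · exact wgt_nonneg _ _ _ _ _
  · refine Finset.sum_nonneg fun ν _ ↦ Finset.sum_nonneg fun μ _ ↦ ?_
    split_ifs
    · exact wgt_nonneg _ _ _ _ _
    · exact le_rfl

/-- `restWgt` vanishes when there are no Dirichlet-polynomial slots. [folklore] -/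
theorem restWgt_empty (T : ℝ) (b : Fin (k + 1) → ℝ) : restWgt T b (∅ : Finset (Fin (k + 1))) ∅ = 0 := by
  classical
  unfold restWgt
  rw [dif_pos rfl]
  have hgood : ∀ ν μ : Fin (Finset.card (∅ : Finset (Fin (k + 1)))) → ℕ, IsGood ν μ := fun ν μ ↦
    ⟨fun i ↦ absurd i.2 (by simp), fun j ↦ absurd j.2 (by simp),
      fun i ↦ absurd i.2 (by simp), fun j ↦ absurd j.2 (by simp)⟩
  have hinj : ∀ ν : Fin (Finset.card (∅ : Finset (Fin (k + 1)))) → ℕ, Function.Injective ν := fun ν i ↦ absurd i.2 (by simp)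
  rw [Finset.sum_eq_zero fun ν _ ↦ Finset.sum_eq_zero fun μ _ ↦ if_neg fun h ↦ h.2 (hgood ν μ),
    Finset.sum_eq_zero fun σ _ ↦ Finset.sum_eq_zero fun ν _ ↦ if_neg (not_not_intro (hinj ν)), add_zero]

/-- The density-integrated error constant `C_D = ∫φ · Kᵏ`. [folklore] -/
def densConst (k : ℕ) : ℝ := bumpMass * (max (2 * ker 0) 1) ^ k

/-- `densConst > 0`. [folklore] -/
theorem densConst_pos (k : ℕ) : 0 < densConst k := by
  unfold densConst; have := bumpMass_pos; positivity

/-- Linearity helper: the density integral of a finite sum of indicator-weighted configuration weights is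
bounded termwise. [folklore] -/
theorem integral_densities_mul_sum_ite_le {T : ℝ} (hT : 3 ≤ T) {D P Q : Finset (Fin (k + 1))}
    (hDP : Disjoint D P) (hDQ : Disjoint D Q) (hPQ : Disjoint P Q) (hcov : ∀ j, j ∈ D ∨ j ∈ P ∨ j ∈ Q)
    {r s : ℕ} (eP : Fin r ≃ P) (eQ : Fin s ≃ Q) {ι : Type*} (A : Finset ι) (cnd : ι → Prop) [DecidablePred cnd]
    (fν : ι → Fin r → ℕ) (fμ : ι → Fin s → ℕ) :
    ∫ η : Fin k → ℝ, (∏ j ∈ D, (g0 (freq T (slicePt η) j)).re) *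
        ∑ a ∈ A, (if cnd a then wgt (freq T (slicePt η)) (fun i ↦ (eP i : Fin (k + 1))) (fun j ↦ (eQ j : Fin (k + 1)))
          (fν a) (fμ a) else 0) ≤
      densConst k / Real.log T ^ k * ∑ a ∈ A, (if cnd a then cfgWeight (fν a) (fμ a) else 0) := by
  have hterm : ∀ a ∈ A, Integrable fun η : Fin k → ℝ ↦ (∏ j ∈ D, (g0 (freq T (slicePt η) j)).re) *
      (if cnd a then wgt (freq T (slicePt η)) (fun i ↦ (eP i : Fin (k + 1))) (fun j ↦ (eQ j : Fin (k + 1))) (fν a) (fμ a) else 0) := by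
    intro a _
    by_cases h : cnd a
    · simp only [if_pos h]; exact integrable_densities_mul_wgt hT hDP hDQ hPQ hcov eP eQ _ _
    · simp only [if_neg h, mul_zero]; exact integrable_zero _ _ _
  simp_rw [Finset.mul_sum]
  rw [integral_finsetSum _ hterm]
  refine Finset.sum_le_sum fun a _ ↦ ?_
  by_cases h : cnd a
  · simp only [if_pos h]
    have := integral_densities_mul_wgt_le hT hDP hDQ hPQ hcov eP eQ (fν a) (fμ a)
    unfold densConst
    exact this
  · simp only [if_neg h, mul_zero, integral_zero]; exact le_rfl

/-- **The density integral of the error weights**: for `T ≥ 3`, `D, P, Q` pairwise disjoint covering all slots,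
`∫_η Π_{j∈D} g₀(b_j) restWgt_{P,Q}(b(ξ(η))) dη ≤ C_D L^{−k} (C_bad L^{|P|+|Q|−1} + [2 ≤ |P| = |Q|] C_co L^{2|P|−2})`.
[cite: RudnickSarnak1996, Lemmas 3.7–3.10] -/
theorem integral_densities_mul_restWgt_le {T : ℝ} (hT : 3 ≤ T) {D P Q : Finset (Fin (k + 1))}
    (hDP : Disjoint D P) (hDQ : Disjoint D Q) (hPQ : Disjoint P Q) (hcov : ∀ j, j ∈ D ∨ j ∈ P ∨ j ∈ Q) :
    ∫ η : Fin k → ℝ, (∏ j ∈ D, (g0 (freq T (slicePt η) j)).re) * restWgt T (freq T (slicePt η)) P Q ≤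
      densConst k / Real.log T ^ k *
        (badConst k * Real.log T ^ (P.card + Q.card - 1) +
          (if 2 ≤ P.card ∧ Q.card = P.card then coincConst k * Real.log T ^ (2 * P.card - 2) else 0)) := by
  classical
  have hL := one_le_log hT
  have hr : P.card ≤ k + 1 := by have := P.card_le_univ; rwa [Fintype.card_fin] at this
  have hs : Q.card ≤ k + 1 := by have := Q.card_le_univ; rwa [Fintype.card_fin] at this
  have hC0 : 0 ≤ densConst k / Real.log T ^ k := div_nonneg (densConst_pos k).le (by positivity)
  unfold restWgt
  by_cases h : Q.card = P.card
  · simp only [dif_pos h]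
    set eP : Fin P.card ≃ P := P.equivFin.symm
    set eQ : Fin P.card ≃ Q := (Finset.equivFinOfCardEq h).symm
    have hwi := integrable_densities_mul_wgt hT hDP hDQ hPQ hcov eP eQ
    have hI1 : Integrable fun η : Fin k → ℝ ↦ (∏ j ∈ D, (g0 (freq T (slicePt η) j)).re) *
        ∑ ν ∈ tuples P.card (primeBound T), ∑ μ ∈ tuples P.card (primeBound T),
          (if ∏ i, ν i = ∏ j, μ j ∧ ¬ IsGood ν μ then
            wgt (freq T (slicePt η)) (fun i ↦ (eP i : Fin (k + 1))) (fun j ↦ (eQ j : Fin (k + 1))) ν μ else 0) := by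
      simp only [Finset.mul_sum]
      refine integrable_finsetSum _ fun ν _ ↦ integrable_finsetSum _ fun μ _ ↦ ?_
      by_cases hc : ∏ i, ν i = ∏ j, μ j ∧ ¬ IsGood ν μ
      · simp only [if_pos hc]; exact hwi ν μ
      · simp only [if_neg hc, mul_zero]; exact integrable_zero _ _ _
    have hI2 : Integrable fun η : Fin k → ℝ ↦ (∏ j ∈ D, (g0 (freq T (slicePt η) j)).re) *
        ∑ σ : Equiv.Perm (Fin P.card), ∑ ν ∈ tuples P.card (primeBound T),
          (if ¬ Function.Injective ν then
            wgt (freq T (slicePt η)) (fun i ↦ (eP i : Fin (k + 1))) (fun j ↦ (eQ j : Fin (k + 1))) ν (ν ∘ σ) else 0) := by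
      simp only [Finset.mul_sum]
      refine integrable_finsetSum _ fun σ _ ↦ integrable_finsetSum _ fun ν _ ↦ ?_
      by_cases hc : ¬ Function.Injective ν
      · simp only [if_pos hc]; exact hwi ν _
      · simp only [if_neg hc, mul_zero]; exact integrable_zero _ _ _
    simp_rw [mul_add]
    rw [integral_add hI1 hI2]
    -- bad part + coincidence part
    have hbad := integral_densities_mul_sum_ite_le hT hDP hDQ hPQ hcov eP eQ
      ((tuples P.card (primeBound T)) ×ˢ (tuples P.card (primeBound T)))
      (fun x ↦ ∏ i, x.1 i = ∏ j, x.2 j ∧ ¬ IsGood x.1 x.2) (fun x ↦ x.1) (fun x ↦ x.2)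
    simp only [Finset.sum_product] at hbad
    have hbad2 := sum_cfgWeight_bad_le_pow (k := k) hT hr hr
    have hco := integral_densities_mul_sum_ite_le hT hDP hDQ hPQ hcov eP eQ
      ((Finset.univ : Finset (Equiv.Perm (Fin P.card))) ×ˢ (tuples P.card (primeBound T)))
      (fun x ↦ ¬ Function.Injective x.2) (fun x ↦ x.2) (fun x ↦ x.2 ∘ x.1)
    simp only [Finset.sum_product] at hco
    refine (add_le_add hbad hco).trans ?_
    rw [h]
    refine add_le_add (mul_le_mul_of_nonneg_left hbad2 hC0) (mul_le_mul_of_nonneg_left ?_ hC0)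
    by_cases h2 : 2 ≤ P.card
    · rw [if_pos ⟨h2, rfl⟩]
      exact sum_perm_sum_not_injective_le_pow hT h2 hr
    · rw [if_neg (fun h' ↦ h2 h'.1)]
      refine le_of_eq (Finset.sum_eq_zero fun σ _ ↦ Finset.sum_eq_zero fun ν _ ↦ if_neg (not_not_intro ?_))
      intro i j _
      have : P.card ≤ 1 := by omega
      exact Fin.ext (by have := i.2; have := j.2; omega)
  · simp only [dif_neg h]
    set eP : Fin P.card ≃ P := P.equivFin.symm
    set eQ : Fin Q.card ≃ Q := Q.equivFin.symm
    have hbad := integral_densities_mul_sum_ite_le hT hDP hDQ hPQ hcov eP eQ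
      ((tuples P.card (primeBound T)) ×ˢ (tuples Q.card (primeBound T)))
      (fun x ↦ ∏ i, x.1 i = ∏ j, x.2 j ∧ ¬ IsGood x.1 x.2) (fun x ↦ x.1) (fun x ↦ x.2)
    simp only [Finset.sum_product] at hbad
    refine hbad.trans (mul_le_mul_of_nonneg_left ?_ hC0)
    refine (sum_cfgWeight_bad_le_pow (k := k) hT hr hs).trans ?_
    have : 0 ≤ (if 2 ≤ P.card ∧ Q.card = P.card then coincConst k * Real.log T ^ (2 * P.card - 2) else 0) := by
      split_ifs
      · unfold coincConst; positivity
      · exact le_rfl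
    linarith

/-! ## Cells, measurability and integrability -/

/-- The diagonal sum with prescribed sides (no sign dependence):
`DS_{P,Q}(b) = Σ_{M ≤ N_{2L}ⁿ} (Π^*_P c_b)(M) (Π^*_Q c_b)(M)`. [cite: RudnickSarnak1996, (3.33)] -/
def sideDiag (T : ℝ) (b : Fin (k + 1) → ℝ) (P Q : Finset (Fin (k + 1))) : ℝ :=
  ∑ M ∈ Finset.Icc 1 (lenBound k T), coefProd P b M * coefProd Q b M

/-- `DS ≥ 0`. [folklore] -/
theorem sideDiag_nonneg (T : ℝ) (b : Fin (k + 1) → ℝ) (P Q : Finset (Fin (k + 1))) : 0 ≤ sideDiag T b P Q := by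
  classical
  exact Finset.sum_nonneg fun M _ ↦ mul_nonneg (coefProd_nonneg _ _ _) (coefProd_nonneg _ _ _)

/-- **The diagonal sum over its sign cells**: `𝔖_S(ξ) = Σ_{P ⊆ S} 1[S⁺(ξ) = P] DS_{P, S∖P}(b(ξ))`. [folklore] -/
theorem diagSum_eq_sum_cells (T : ℝ) (ξ : Fin (k + 1) → ℝ) (S : Finset (Fin (k + 1))) :
    diagSum T ξ S = ∑ P ∈ S.powerset, (if posSide ξ S = P then sideDiag T (freq T ξ) P (S \ P) else 0) := by
  rw [Finset.sum_ite_eq_of_mem]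
  · unfold diagSum sideDiag
    congr 1 with M
    congr 2
    rw [← filter_not_posSide, Finset.filter_not]
    rfl
  · exact Finset.mem_powerset.2 (Finset.filter_subset _ _)

/-- The frequencies are continuous functions of `η`. [folklore] -/
theorem continuous_freq_slicePt (T : ℝ) : Continuous fun η : Fin k → ℝ ↦ freq T (slicePt η) := by
  refine continuous_pi fun j ↦ ?_
  unfold freq
  exact continuous_const.mul ((continuous_slicePt_apply j).abs)

/-- `a ↦ c_a(m)` is continuous. [folklore] -/
theorem continuous_coefR_left (m : ℕ) : Continuous fun a : ℝ ↦ coefR a m := by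
  unfold coefR
  exact continuous_const.mul (Complex.continuous_re.comp (continuous_g0.comp (continuous_const.sub continuous_id)))

/-- `b ↦ (Π^*_P c_b)(M)` is continuous. [folklore] -/
theorem continuous_coefProd_apply (P : Finset (Fin (k + 1))) (M : ℕ) :
    Continuous fun b : Fin (k + 1) → ℝ ↦ coefProd P b M := by
  have e : (fun b : Fin (k + 1) → ℝ ↦ coefProd P b M) =
      fun b ↦ ∑ ν ∈ Nat.finMulAntidiag P.card M, ∏ i, coefR (b (P.equivFin.symm i)) (ν i) :=
    funext fun b ↦ coefProd_apply_eq_sum b P P.equivFin.symm M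
  rw [e]
  refine continuous_finsetSum _ fun ν _ ↦ continuous_finsetProd _ fun i _ ↦ ?_
  exact (continuous_coefR_left _).comp (continuous_apply _)

/-- `b ↦ DS_{P,Q}(b)` is continuous. [folklore] -/
theorem continuous_sideDiag (T : ℝ) (P Q : Finset (Fin (k + 1))) :
    Continuous fun b : Fin (k + 1) → ℝ ↦ sideDiag T b P Q :=
  continuous_finsetSum _ fun M _ ↦ (continuous_coefProd_apply P M).mul (continuous_coefProd_apply Q M)

/-- `(x, y) ↦ 𝒫_T(x, y)` is continuous. [folklore] -/
theorem continuous_primePair (T : ℝ) : Continuous fun p : ℝ × ℝ ↦ primePair T p.1 p.2 := by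
  unfold primePair
  refine continuous_finsetSum _ fun m _ ↦ ?_
  exact continuous_if_const _ (fun _ ↦ ((continuous_coefR_left m).comp continuous_fst).mul
    ((continuous_coefR_left m).comp continuous_snd)) (fun _ ↦ continuous_const)

/-- `b ↦ pairMain_{P,Q}(b)` is continuous. [folklore] -/
theorem continuous_pairMain (T : ℝ) (P Q : Finset (Fin (k + 1))) :
    Continuous fun b : Fin (k + 1) → ℝ ↦ pairMain T b P Q := by
  unfold pairMain
  refine continuous_finsetSum _ fun β _ ↦ continuous_finsetProd _ fun p _ ↦ ?_
  have h1 : Continuous fun b : Fin (k + 1) → ℝ ↦ b (p : Fin (k + 1)) := continuous_apply _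
  have h2 : Continuous fun b : Fin (k + 1) → ℝ ↦ b ((β p : Q) : Fin (k + 1)) := continuous_apply _
  exact (continuous_primePair T).comp₂ h1 h2

/-- **The sign cells are measurable**: `{η : S⁺(ξ(η)) = P}` is a measurable set. [folklore] -/
theorem measurableSet_cell (S P : Finset (Fin (k + 1))) :
    MeasurableSet {η : Fin k → ℝ | posSide (slicePt η) S = P} := by
  by_cases hP : P ⊆ S
  · have e : {η : Fin k → ℝ | posSide (slicePt η) S = P} = ⋂ j ∈ S, {η : Fin k → ℝ | slicePt η j ≤ 0 ↔ j ∈ P} := by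
      ext η
      simp only [Set.mem_setOf_eq, Set.mem_iInter]
      unfold posSide
      constructor
      · intro h j hj
        rw [← h, Finset.mem_filter]
        exact ⟨fun h' ↦ ⟨hj, h'⟩, fun h' ↦ h'.2⟩
      · intro h
        ext j
        rw [Finset.mem_filter]
        constructor
        · rintro ⟨hj, h'⟩; exact (h j hj).1 h'
        · intro hj; exact ⟨hP hj, (h j (hP hj)).2 hj⟩
    rw [e]
    refine Finset.measurableSet_biInter S fun j _ ↦ ?_
    by_cases hj : j ∈ P
    · have : {η : Fin k → ℝ | slicePt η j ≤ 0 ↔ j ∈ P} = {η | slicePt η j ≤ 0} := by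
        ext η; simp [hj]
      rw [this]
      exact measurableSet_le (continuous_slicePt_apply j).measurable measurable_const
    · have : {η : Fin k → ℝ | slicePt η j ≤ 0 ↔ j ∈ P} = {η | 0 < slicePt η j} := by
        ext η; simp [hj, not_le]
      rw [this]
      exact measurableSet_lt measurable_const (continuous_slicePt_apply j).measurable
  · have e : {η : Fin k → ℝ | posSide (slicePt η) S = P} = ∅ := by
      ext η
      simp only [Set.mem_setOf_eq, Set.mem_empty_iff_false, iff_false]
      intro h
      exact hP (h ▸ Finset.filter_subset _ _)
    rw [e]
    exact MeasurableSet.empty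

/-- Measurability of a cell-restricted continuous functional of the frequencies times the densities. [folklore] -/
theorem measurable_densities_mul_cell (T : ℝ) (D S P : Finset (Fin (k + 1))) {F : (Fin (k + 1) → ℝ) → ℝ}
    (hF : Continuous F) :
    Measurable fun η : Fin k → ℝ ↦ (∏ j ∈ D, (g0 (freq T (slicePt η) j)).re) *
      (if posSide (slicePt η) S = P then F (freq T (slicePt η)) else 0) := by
  classical
  refine Measurable.mul ?_ (Measurable.ite (measurableSet_cell S P) (hF.comp (continuous_freq_slicePt T)).measurable
    measurable_const)
  exact (continuous_finsetProd _ fun j _ ↦ Complex.continuous_re.comp (continuous_g0.comp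
    ((continuous_apply j).comp (continuous_freq_slicePt T)))).measurable

/-- A uniform bound for `DS_{P,Q}(b)`. [folklore] -/
theorem sideDiag_le (T : ℝ) (b : Fin (k + 1) → ℝ) (P Q : Finset (Fin (k + 1))) :
    sideDiag T b P Q ≤ (lenBound k T + 1) *
      ((max bumpMass 1) ^ (k + 1) * (Real.log (lenBound k T) + 1) ^ (k + 1)) ^ 2 := by
  classical
  set B := lenBound k T
  set X : ℝ := (max bumpMass 1) ^ (k + 1) * (Real.log B + 1) ^ (k + 1)
  have hBg : 1 ≤ max bumpMass 1 := le_max_right _ _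
  have hlog0 : 0 ≤ Real.log (B : ℝ) := Real.log_natCast_nonneg _
  have hcoef : ∀ (S : Finset (Fin (k + 1))) (M : ℕ), M ∈ Finset.Icc 1 B → coefProd S b M ≤ X := by
    intro S M hM
    rw [Finset.mem_Icc] at hM
    have hM1 : (1 : ℝ) ≤ M := by exact_mod_cast hM.1
    have hcard : S.card ≤ k + 1 := by have := S.card_le_univ; rwa [Fintype.card_fin] at this
    refine (coefProd_le S b M).trans ?_
    have h1 : ((Λ : ArithmeticFunction ℝ) ^ S.card) M ≤ Real.log M ^ S.card := vonMangoldt_pow_le _ _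
    have h2 : Real.log M ≤ Real.log B + 1 := by
      have := Real.log_le_log (by linarith) (show (M : ℝ) ≤ B by exact_mod_cast hM.2); linarith
    have hlogM : 0 ≤ Real.log (M : ℝ) := Real.log_nonneg hM1
    have h3 : Real.sqrt M ≥ 1 := by rw [ge_iff_le, Real.one_le_sqrt]; exact hM1
    calc bumpMass ^ S.card * ((Λ : ArithmeticFunction ℝ) ^ S.card) M / Real.sqrt M
        ≤ bumpMass ^ S.card * ((Λ : ArithmeticFunction ℝ) ^ S.card) M := by
          refine div_le_self (mul_nonneg (pow_nonneg bumpMass_pos.le _) (vonMangoldt_pow_nonneg _ _)) h3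
      _ ≤ (max bumpMass 1) ^ (k + 1) * (Real.log B + 1) ^ (k + 1) := by
          refine mul_le_mul ?_ (h1.trans ?_) (vonMangoldt_pow_nonneg _ _) (by positivity)
          · exact (pow_le_pow_left₀ bumpMass_pos.le (le_max_left _ _) _).trans (pow_le_pow_right₀ hBg hcard)
          · exact (pow_le_pow_left₀ hlogM h2 _).trans (pow_le_pow_right₀ (by linarith) hcard)
  have hX0 : 0 ≤ X := by positivity
  unfold sideDiag
  calc ∑ M ∈ Finset.Icc 1 B, coefProd P b M * coefProd Q b M ≤ ∑ _M ∈ Finset.Icc 1 B, X * X :=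
        Finset.sum_le_sum fun M hM ↦ mul_le_mul (hcoef P M hM) (hcoef Q M hM) (coefProd_nonneg _ _ _) hX0
    _ = B * (X * X) := by rw [Finset.sum_const, Nat.card_Icc, nsmul_eq_mul]; push_cast; ring
    _ ≤ (B + 1) * X ^ 2 := by rw [sq]; nlinarith [mul_nonneg hX0 hX0]

/-- A uniform bound for `pairMain`. [folklore] -/
theorem pairMain_le (T : ℝ) (b : Fin (k + 1) → ℝ) (P Q : Finset (Fin (k + 1))) :
    pairMain T b P Q ≤ Fintype.card (P ≃ Q) *
      (max 1 (∑ m ∈ Finset.Icc 1 (primeBound T), bumpMass ^ 2 * ((Λ m : ℝ) ^ 2 / m))) ^ (k + 1) := by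
  set Y : ℝ := ∑ m ∈ Finset.Icc 1 (primeBound T), bumpMass ^ 2 * ((Λ m : ℝ) ^ 2 / m)
  have hY1 : 1 ≤ max 1 Y := le_max_left _ _
  have hpp : ∀ x y, primePair T x y ≤ max 1 Y := fun x y ↦ by
    refine le_trans ?_ (le_max_right _ _)
    unfold primePair
    refine Finset.sum_le_sum fun m hm ↦ ?_
    have hm1 : (0 : ℝ) < m := by rw [Finset.mem_Icc] at hm; exact_mod_cast hm.1
    have hb : coefR x m * coefR y m ≤ bumpMass ^ 2 * ((Λ m : ℝ) ^ 2 / m) := by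
      have h1 := coefR_le x m
      have h2 := coefR_le y m
      calc coefR x m * coefR y m ≤ (bumpMass * (Λ m / Real.sqrt m)) * (bumpMass * (Λ m / Real.sqrt m)) :=
            mul_le_mul h1 h2 (coefR_nonneg _ _) ((coefR_nonneg _ _).trans h1)
        _ = bumpMass ^ 2 * ((Λ m : ℝ) ^ 2 / m) := by
            rw [show bumpMass * ((Λ m : ℝ) / Real.sqrt m) * (bumpMass * ((Λ m : ℝ) / Real.sqrt m)) =
              bumpMass ^ 2 * ((Λ m : ℝ) ^ 2 / (Real.sqrt m * Real.sqrt m)) by ring, Real.mul_self_sqrt hm1.le]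
    split_ifs
    · exact hb
    · have := bumpMass_pos; positivity
  unfold pairMain
  calc ∑ β : (P ≃ Q), ∏ p : P, primePair T (b p) (b (β p)) ≤ ∑ _β : (P ≃ Q), (max 1 Y) ^ (k + 1) := by
        refine Finset.sum_le_sum fun β _ ↦ ?_
        calc ∏ p : P, primePair T (b p) (b (β p)) ≤ ∏ _p : P, max 1 Y :=
              Finset.prod_le_prod (fun p _ ↦ primePair_nonneg _ _ _) fun p _ ↦ hpp _ _
          _ = (max 1 Y) ^ Fintype.card P := by rw [Finset.prod_const, Finset.card_univ]
          _ ≤ (max 1 Y) ^ (k + 1) := pow_le_pow_right₀ hY1 (by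
              rw [Fintype.card_coe]; have := P.card_le_univ; rwa [Fintype.card_fin] at this)
    _ = _ := by rw [Finset.sum_const, Finset.card_univ, nsmul_eq_mul]

/-- Integrability of `Φ(ξ(η)) · Π_D g₀ · 1_{cell} F(b)` for bounded continuous `F` and `Φ` integrable on the slice.
[folklore] -/
theorem integrable_phi_mul_cell {Φ : (Fin (k + 1) → ℝ) → ℂ} (hΦ : Integrable fun η : Fin k → ℝ ↦ Φ (slicePt η))
    (T : ℝ) (D S P : Finset (Fin (k + 1))) {F : (Fin (k + 1) → ℝ) → ℝ} (hF : Continuous F) {B : ℝ}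
    (hB : ∀ b, |F b| ≤ B) :
    Integrable fun η : Fin k → ℝ ↦ Φ (slicePt η) * (((∏ j ∈ D, (g0 (freq T (slicePt η) j)).re) *
      (if posSide (slicePt η) S = P then F (freq T (slicePt η)) else 0) : ℝ) : ℂ) := by
  classical
  have hmeas := measurable_densities_mul_cell T D S P hF
  have hbdd : ∀ η : Fin k → ℝ, ‖(((∏ j ∈ D, (g0 (freq T (slicePt η) j)).re) *
      (if posSide (slicePt η) S = P then F (freq T (slicePt η)) else 0) : ℝ) : ℂ)‖ ≤ (max bumpMass 1) ^ (k + 1) * max B 0 := by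
    intro η
    rw [Complex.norm_real, Real.norm_eq_abs, abs_mul]
    refine mul_le_mul ?_ ?_ (abs_nonneg _) (by positivity)
    · rw [abs_of_nonneg (Finset.prod_nonneg fun j _ ↦ g0_re_nonneg _), ]
      have hcard : D.card ≤ k + 1 := by have := D.card_le_univ; rwa [Fintype.card_fin] at this
      calc ∏ j ∈ D, (g0 (freq T (slicePt η) j)).re ≤ ∏ _j ∈ D, max bumpMass 1 :=
            Finset.prod_le_prod (fun j _ ↦ g0_re_nonneg _) fun j _ ↦ (g0_re_le _).trans (le_max_left _ _)
        _ = (max bumpMass 1) ^ D.card := Finset.prod_const _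
        _ ≤ (max bumpMass 1) ^ (k + 1) := pow_le_pow_right₀ (le_max_right _ _) hcard
    · split_ifs
      · exact (hB _).trans (le_max_left _ _)
      · rw [abs_zero]; exact le_max_right _ _
  have h := hΦ.bdd_mul (c := (max bumpMass 1) ^ (k + 1) * max B 0)
    (Complex.measurable_ofReal.comp hmeas).aestronglyMeasurable (Eventually.of_forall hbdd)
  refine h.congr (Eventually.of_forall fun η ↦ ?_)
  simp only [Function.comp_apply]
  ring

/-! ## The main term and the two estimates -/

/-- Disjointness and covering data for `D`, `P ⊆ Dᶜ`, `Q = Dᶜ ∖ P`. [folklore] -/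
theorem cell_disjoint (D P : Finset (Fin (k + 1))) (hP : P ⊆ Finset.univ \ D) :
    Disjoint D P ∧ Disjoint D ((Finset.univ \ D) \ P) ∧ Disjoint P ((Finset.univ \ D) \ P) ∧
      ∀ j, j ∈ D ∨ j ∈ P ∨ j ∈ (Finset.univ \ D) \ P := by
  refine ⟨?_, ?_, Finset.disjoint_sdiff, fun j ↦ ?_⟩
  · exact Finset.disjoint_of_subset_right hP Finset.disjoint_sdiff
  · exact Finset.disjoint_of_subset_right Finset.sdiff_subset Finset.disjoint_sdiff
  · by_cases hD : j ∈ D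
    · exact Or.inl hD
    · by_cases hPj : j ∈ P
      · exact Or.inr (Or.inl hPj)
      · refine Or.inr (Or.inr ?_)
        simp [hD, hPj]

/-- On the box `|ξ_j| ≤ 2`, `b_j ≤ 2L` (`T ≥ 1`). [folklore] -/
theorem freq_le_of_box {T : ℝ} (hT : 1 ≤ T) {ξ : Fin (k + 1) → ℝ} (hbox : ∀ j, |ξ j| ≤ 2) (j : Fin (k + 1)) :
    freq T ξ j ≤ 2 * Real.log T := by
  unfold freq; have := Real.log_nonneg hT; nlinarith [hbox j, abs_nonneg (ξ j)]

/-- Integrability of the densities times the error weights. [folklore] -/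
theorem integrable_densities_mul_restWgt {T : ℝ} (hT : 3 ≤ T) {D P Q : Finset (Fin (k + 1))}
    (hDP : Disjoint D P) (hDQ : Disjoint D Q) (hPQ : Disjoint P Q) (hcov : ∀ j, j ∈ D ∨ j ∈ P ∨ j ∈ Q) :
    Integrable fun η : Fin k → ℝ ↦ (∏ j ∈ D, (g0 (freq T (slicePt η) j)).re) * restWgt T (freq T (slicePt η)) P Q := by
  classical
  unfold restWgt
  by_cases h : Q.card = P.card
  · simp only [dif_pos h]
    set eP : Fin P.card ≃ P := P.equivFin.symm
    set eQ : Fin P.card ≃ Q := (Finset.equivFinOfCardEq h).symm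
    have hwi := integrable_densities_mul_wgt hT hDP hDQ hPQ hcov eP eQ
    simp only [mul_add, Finset.mul_sum]
    refine Integrable.add (integrable_finsetSum _ fun ν _ ↦ integrable_finsetSum _ fun μ _ ↦ ?_)
      (integrable_finsetSum _ fun σ _ ↦ integrable_finsetSum _ fun ν _ ↦ ?_)
    · by_cases hc : ∏ i, ν i = ∏ j, μ j ∧ ¬ IsGood ν μ
      · simp only [if_pos hc]; exact hwi ν μ
      · simp only [if_neg hc, mul_zero]; exact integrable_zero _ _ _
    · by_cases hc : ¬ Function.Injective ν
      · simp only [if_pos hc]; exact hwi ν _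
      · simp only [if_neg hc, mul_zero]; exact integrable_zero _ _ _
  · simp only [dif_neg h]
    set eP : Fin P.card ≃ P := P.equivFin.symm
    set eQ : Fin Q.card ≃ Q := Q.equivFin.symm
    have hwi := integrable_densities_mul_wgt hT hDP hDQ hPQ hcov eP eQ
    simp only [Finset.mul_sum]
    refine integrable_finsetSum _ fun ν _ ↦ integrable_finsetSum _ fun μ _ ↦ ?_
    by_cases hc : ∏ i, ν i = ∏ j, μ j ∧ ¬ IsGood ν μ
    · simp only [if_pos hc]; exact hwi ν μ
    · simp only [if_neg hc, mul_zero]; exact integrable_zero _ _ _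

/-- Card bookkeeping: `|D| + |Dᶜ| = n`. [folklore] -/
theorem card_add_card_sdiff (D : Finset (Fin (k + 1))) : D.card + (Finset.univ \ D).card = k + 1 := by
  rw [Finset.card_sdiff_of_subset (Finset.subset_univ D), Finset.card_univ, Fintype.card_fin]
  have := D.card_le_univ; rw [Fintype.card_fin] at this; omega

/-- Card bookkeeping: `|P| + |Dᶜ ∖ P| = |Dᶜ|` for `P ⊆ Dᶜ`. [folklore] -/
theorem card_add_card_sdiff' {D P : Finset (Fin (k + 1))} (hP : P ⊆ Finset.univ \ D) :
    P.card + ((Finset.univ \ D) \ P).card = (Finset.univ \ D).card := by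
  rw [Finset.card_sdiff_of_subset hP]; have := Finset.card_le_card hP; omega

/-- The error constant of the main-term extraction. [folklore] -/
def mainErrConst (k : ℕ) : ℝ := 4 ^ (k + 1) * (densConst k * 5 ^ (k + 1) * (badConst k + coincConst k))

/-- The constant of the uniform bound. [folklore] -/
def unifConst (k : ℕ) : ℝ := 4 ^ (k + 1) * (densConst k * 5 ^ (k + 1) * ((3 * (k + 1)) ^ (k + 1) * 9 ^ (k + 1)))

/-- The density factor `Π_{j∈D} g₀(b_j(ξ(η)))`. [folklore] -/
def densG (T : ℝ) (D : Finset (Fin (k + 1))) (η : Fin k → ℝ) : ℝ := ∏ j ∈ D, (g0 (freq T (slicePt η) j)).re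

/-- `densG ≥ 0`. [folklore] -/
theorem densG_nonneg (T : ℝ) (D : Finset (Fin (k + 1))) (η : Fin k → ℝ) : 0 ≤ densG T D η :=
  Finset.prod_nonneg fun _ _ ↦ g0_re_nonneg _

/-- The cell-restricted diagonal sum `1[Dᶜ⁺(ξ) = P] DS_{P, Dᶜ∖P}(b(ξ))`. [folklore] -/
def cellDiag (T : ℝ) (D P : Finset (Fin (k + 1))) (η : Fin k → ℝ) : ℝ :=
  if posSide (slicePt η) (Finset.univ \ D) = P then sideDiag T (freq T (slicePt η)) P ((Finset.univ \ D) \ P) else 0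

/-- The cell-restricted main term `1[Dᶜ⁺(ξ) = P] pairMain_{P, Dᶜ∖P}(b(ξ))`. [folklore] -/
def cellPair (T : ℝ) (D P : Finset (Fin (k + 1))) (η : Fin k → ℝ) : ℝ :=
  if posSide (slicePt η) (Finset.univ \ D) = P then pairMain T (freq T (slicePt η)) P ((Finset.univ \ D) \ P) else 0

/-- The coefficient `(−1)^{|Dᶜ|} I_{|D|}(T)`. [folklore] -/
def cellCoef (T : ℝ) (D : Finset (Fin (k + 1))) : ℂ := (-1 : ℂ) ^ (Finset.univ \ D).card * (ellInt D.card T : ℂ)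

/-- **The cell integral of the main term**: for the set `D` of density slots and `P ⊆ Dᶜ` the slots
with `ξ_j ≤ 0`, `∫_η Φ(ξ) Π_{j∈D} g₀(b_j) 1[Dᶜ⁺(ξ) = P] pairMain_{P, Dᶜ∖P}(b(ξ)) dη`.
[cite: RudnickSarnak1996, Lemma 3.10] -/
def cellMain (Φ : (Fin (k + 1) → ℝ) → ℂ) (T : ℝ) (D P : Finset (Fin (k + 1))) : ℂ :=
  ∫ η : Fin k → ℝ, Φ (slicePt η) * ((densG T D η * cellPair T D P η : ℝ) : ℂ)

/-- **The main term**: `Σ_D Σ_{P ⊆ Dᶜ} (−1)^{|Dᶜ|} I_{|D|}(T) · cellMain(D, P)`. [cite: RudnickSarnak1996, (3.65)] -/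
def mainSum (Φ : (Fin (k + 1) → ℝ) → ℂ) (T : ℝ) : ℂ :=
  ∑ D ∈ (Finset.univ : Finset (Fin (k + 1))).powerset, ∑ P ∈ (Finset.univ \ D).powerset,
    cellCoef T D * cellMain Φ T D P

/-- Pointwise expansion of `Φ · 𝔓_T` over cells. [folklore] -/
theorem phi_mul_patternSum_eq (Φ : (Fin (k + 1) → ℝ) → ℂ) (T : ℝ) (η : Fin k → ℝ) :
    Φ (slicePt η) * patternSum T (slicePt η) =
      ∑ D ∈ (Finset.univ : Finset (Fin (k + 1))).powerset, ∑ P ∈ (Finset.univ \ D).powerset,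
        cellCoef T D * (Φ (slicePt η) * ((densG T D η * cellDiag T D P η : ℝ) : ℂ)) := by
  unfold patternSum
  rw [Finset.mul_sum]
  refine Finset.sum_congr rfl fun D _ ↦ ?_
  rw [diagSum_eq_sum_cells]
  simp only [cellCoef, densG, cellDiag, Complex.ofReal_sum, Complex.ofReal_mul, Finset.mul_sum]
  refine Finset.sum_congr rfl fun P _ ↦ ?_
  unfold freq
  ring

/-- `‖cellCoef‖ ≤ T (5L)^{|D|}`. [folklore] -/
theorem norm_cellCoef_le {T : ℝ} (hT : 3 ≤ T) (D : Finset (Fin (k + 1))) :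
    ‖cellCoef T D‖ ≤ T * (5 * Real.log T) ^ D.card := by
  unfold cellCoef
  rw [norm_mul, norm_pow, norm_neg, norm_one, one_pow, one_mul, Complex.norm_real, Real.norm_eq_abs]
  exact abs_ellInt_le' hT _

/-- The power count of the bad configurations: `(5L)^{|D|} L^{−k} L^{|S|−1} ≤ 5ⁿ` when `|D| + |S| = n`, `|S| ≥ 1`.
[folklore] -/
theorem pow_count_bad {T : ℝ} (hT : 3 ≤ T) {d e : ℕ} (h : d + e = k) (hd : d ≤ k + 1) :
    (5 * Real.log T) ^ d / Real.log T ^ k * Real.log T ^ e ≤ 5 ^ (k + 1) := by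
  have hL := one_le_log hT
  rw [mul_pow, mul_div_assoc, mul_assoc, div_mul_eq_mul_div, ← pow_add, h, div_self (by positivity), mul_one]
  exact pow_le_pow_right₀ (by norm_num) hd

/-- The power count of the coincidences: `(5L)^{|D|} L^{−k} L^{e} ≤ 5ⁿ` when `|D| + e ≤ k`. [folklore] -/
theorem pow_count_coinc {T : ℝ} (hT : 3 ≤ T) {d e : ℕ} (h : d + e ≤ k) (hd : d ≤ k + 1) :
    (5 * Real.log T) ^ d / Real.log T ^ k * Real.log T ^ e ≤ 5 ^ (k + 1) := by
  have hL := one_le_log hT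
  have hL0 : 0 < Real.log T := by linarith
  rw [mul_pow, mul_div_assoc, mul_assoc, div_mul_eq_mul_div, ← pow_add]
  calc (5 : ℝ) ^ d * (Real.log T ^ (d + e) / Real.log T ^ k) ≤ 5 ^ (k + 1) * 1 := by
        refine mul_le_mul (pow_le_pow_right₀ (by norm_num) hd) ?_ (by positivity) (by positivity)
        rw [div_le_one (by positivity)]
        exact pow_le_pow_right₀ hL h
    _ = 5 ^ (k + 1) := mul_one _

/-- The power count of the uniform bound: `(5L)^{d} L^{−k} L^{e} = 5^d L` when `d + e = n`. [folklore] -/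
theorem pow_count_unif {T : ℝ} (hT : 3 ≤ T) {d e : ℕ} (h : d + e = k + 1) :
    (5 * Real.log T) ^ d / Real.log T ^ k * Real.log T ^ e = 5 ^ d * Real.log T := by
  have hL := one_le_log hT
  have hL0 : Real.log T ≠ 0 := by linarith
  rw [mul_pow, mul_div_assoc, mul_assoc, div_mul_eq_mul_div, ← pow_add, h, pow_succ]
  field_simp

/-- Integrability of `Φ · Π_D g₀ · 1_{cell} DS`. [folklore] -/
theorem integrable_phi_cellDiag {Φ : (Fin (k + 1) → ℝ) → ℂ} (hΦi : Integrable fun η : Fin k → ℝ ↦ Φ (slicePt η))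
    (T : ℝ) (D P : Finset (Fin (k + 1))) :
    Integrable fun η : Fin k → ℝ ↦ Φ (slicePt η) * ((densG T D η * cellDiag T D P η : ℝ) : ℂ) := by
  have h := integrable_phi_mul_cell hΦi T D (Finset.univ \ D) P
    (F := fun b ↦ sideDiag T b P ((Finset.univ \ D) \ P))
    (B := (lenBound k T + 1) * ((max bumpMass 1) ^ (k + 1) * (Real.log (lenBound k T) + 1) ^ (k + 1)) ^ 2)
    (continuous_sideDiag T P _) (fun b ↦ by
      rw [abs_of_nonneg (sideDiag_nonneg _ _ _ _)]; exact sideDiag_le T b P _)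
  simpa only [densG, cellDiag] using h

/-- **`∫ Φ 𝔓_T` over the cells**: `∫_η Φ(ξ) 𝔓_T(ξ) dη = Σ_D Σ_{P ⊆ Dᶜ} cellCoef(D) ∫_η Φ(ξ) Π_D g₀ 1_{cell} DS`.
[folklore] -/
theorem integral_phi_mul_patternSum_eq {Φ : (Fin (k + 1) → ℝ) → ℂ} (hΦi : Integrable fun η : Fin k → ℝ ↦ Φ (slicePt η))
    (T : ℝ) :
    ∫ η : Fin k → ℝ, Φ (slicePt η) * patternSum T (slicePt η) =
      ∑ D ∈ (Finset.univ : Finset (Fin (k + 1))).powerset, ∑ P ∈ (Finset.univ \ D).powerset,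
        cellCoef T D * ∫ η : Fin k → ℝ, Φ (slicePt η) * ((densG T D η * cellDiag T D P η : ℝ) : ℂ) := by
  have hintF := integrable_phi_cellDiag hΦi T
  rw [integral_congr_ae (Eventually.of_forall (phi_mul_patternSum_eq Φ T))]
  rw [integral_finsetSum _ fun D _ ↦ integrable_finsetSum _ fun P _ ↦ (hintF D P).const_mul _]
  refine Finset.sum_congr rfl fun D _ ↦ ?_
  rw [integral_finsetSum _ fun P _ ↦ (hintF D P).const_mul _]
  refine Finset.sum_congr rfl fun P _ ↦ ?_
  exact integral_const_mul _ _

/-- **The pattern sum integrated against `Φ` is the main term up to `O(‖Φ‖_∞ T)`** (Rudnick–Sarnak 1996,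
Lemmas 3.7–3.10 with the slice integration of `RudnickSarnakNExchange.lean`): for `T ≥ 3` and `Φ`
integrable on the slice, bounded by `M_Φ` and supported in the box `|ξ_j| ≤ 2`,
`‖∫_η Φ(ξ(η)) 𝔓_T(ξ(η)) dη − mainSum Φ T‖ ≤ C(n) M_Φ T`. [cite: RudnickSarnak1996, Lemmas 3.7–3.10] -/
theorem norm_integral_patternSum_sub_mainSum_le {T : ℝ} (hT : 3 ≤ T) {Φ : (Fin (k + 1) → ℝ) → ℂ} {MΦ : ℝ}
    (hΦi : Integrable fun η : Fin k → ℝ ↦ Φ (slicePt η)) (hΦb : ∀ ξ, ‖Φ ξ‖ ≤ MΦ)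
    (hΦs : ∀ ξ, Φ ξ ≠ 0 → ∀ j, |ξ j| ≤ 2) :
    ‖(∫ η : Fin k → ℝ, Φ (slicePt η) * patternSum T (slicePt η)) - mainSum Φ T‖ ≤ mainErrConst k * MΦ * T := by
  classical
  have hT1 : (1 : ℝ) ≤ T := by linarith
  have hT0 : (0 : ℝ) ≤ T := by linarith
  have hL := one_le_log hT
  have hM0 : 0 ≤ MΦ := (norm_nonneg _).trans (hΦb 0)
  have hdc := (densConst_pos k).le
  have hbad0 : 0 ≤ badConst k := by unfold badConst; positivity
  have hco0 : 0 ≤ coincConst k := by unfold coincConst; positivity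
  -- integrability of the cell terms
  have hintF := integrable_phi_cellDiag hΦi T
  have hintM : ∀ D P : Finset (Fin (k + 1)), Integrable fun η : Fin k → ℝ ↦
      Φ (slicePt η) * ((densG T D η * cellPair T D P η : ℝ) : ℂ) := by
    intro D P
    have h := integrable_phi_mul_cell hΦi T D (Finset.univ \ D) P
      (F := fun b ↦ pairMain T b P ((Finset.univ \ D) \ P))
      (B := Fintype.card (↥P ≃ ↥((Finset.univ \ D) \ P)) *
        (max 1 (∑ m ∈ Finset.Icc 1 (primeBound T), bumpMass ^ 2 * ((Λ m : ℝ) ^ 2 / m))) ^ (k + 1))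
      (continuous_pairMain T P _) (fun b ↦ by
        rw [abs_of_nonneg (pairMain_nonneg _ _ _ _)]; exact pairMain_le T b P _)
    simpa only [densG, cellPair] using h
  -- both sides as double sums
  have hlhs : ∫ η : Fin k → ℝ, Φ (slicePt η) * patternSum T (slicePt η) =
      ∑ D ∈ (Finset.univ : Finset (Fin (k + 1))).powerset, ∑ P ∈ (Finset.univ \ D).powerset,
        cellCoef T D * ∫ η : Fin k → ℝ, Φ (slicePt η) * ((densG T D η * cellDiag T D P η : ℝ) : ℂ) := by
    rw [integral_congr_ae (Eventually.of_forall (phi_mul_patternSum_eq Φ T))]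
    rw [integral_finsetSum _ fun D _ ↦ integrable_finsetSum _ fun P _ ↦ (hintF D P).const_mul _]
    refine Finset.sum_congr rfl fun D _ ↦ ?_
    rw [integral_finsetSum _ fun P _ ↦ (hintF D P).const_mul _]
    refine Finset.sum_congr rfl fun P _ ↦ ?_
    exact integral_const_mul _ _
  rw [hlhs]
  unfold mainSum cellMain
  rw [← Finset.sum_sub_distrib]
  simp_rw [← Finset.sum_sub_distrib, ← mul_sub]
  -- the per-cell estimate
  set X : ℝ := MΦ * T * (densConst k * 5 ^ (k + 1) * (badConst k + coincConst k))
  have hX0 : 0 ≤ X := by positivity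
  have hcell : ∀ D ∈ (Finset.univ : Finset (Fin (k + 1))).powerset, ∀ P ∈ (Finset.univ \ D).powerset,
      ‖cellCoef T D * ((∫ η : Fin k → ℝ, Φ (slicePt η) * ((densG T D η * cellDiag T D P η : ℝ) : ℂ)) -
        ∫ η : Fin k → ℝ, Φ (slicePt η) * ((densG T D η * cellPair T D P η : ℝ) : ℂ))‖ ≤ X := by
    intro D _ P hP
    rw [Finset.mem_powerset] at hP
    obtain ⟨hDP, hDQ, hPQ, hcov⟩ := cell_disjoint D P hP
    have hcardS : D.card + (Finset.univ \ D).card = k + 1 := card_add_card_sdiff D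
    have hcardPQ : P.card + ((Finset.univ \ D) \ P).card = (Finset.univ \ D).card := card_add_card_sdiff' hP
    have hcardD : D.card ≤ k + 1 := by omega
    rw [← integral_sub (hintF D P) (hintM D P), norm_mul]
    -- the integral of the difference
    have hdiff : ‖∫ η : Fin k → ℝ, (Φ (slicePt η) * ((densG T D η * cellDiag T D P η : ℝ) : ℂ) -
        Φ (slicePt η) * ((densG T D η * cellPair T D P η : ℝ) : ℂ))‖ ≤
        MΦ * ∫ η : Fin k → ℝ, densG T D η * restWgt T (freq T (slicePt η)) P ((Finset.univ \ D) \ P) := by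
      rw [← integral_const_mul]
      refine (norm_integral_le_integral_norm _).trans (integral_mono ((hintF D P).sub (hintM D P)).norm
        ((integrable_densities_mul_restWgt hT hDP hDQ hPQ hcov).const_mul MΦ) fun η ↦ ?_)
      dsimp only
      rw [← mul_sub, norm_mul, ← Complex.ofReal_sub, Complex.norm_real, Real.norm_eq_abs, ← mul_sub, abs_mul,
        abs_of_nonneg (densG_nonneg T D η)]
      by_cases hΦ0 : Φ (slicePt η) = 0
      · rw [hΦ0, norm_zero, zero_mul]
        exact mul_nonneg hM0 (mul_nonneg (densG_nonneg T D η) (restWgt_nonneg _ _ _ _))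
      · have hbox := hΦs _ hΦ0
        have hb : ∀ j, freq T (slicePt η) j ≤ 2 * Real.log T := freq_le_of_box hT1 hbox
        have hcd : |cellDiag T D P η - cellPair T D P η| ≤ restWgt T (freq T (slicePt η)) P ((Finset.univ \ D) \ P) := by
          unfold cellDiag cellPair
          split_ifs
          · exact abs_sum_coefProd_mul_sub_pairMain_le hT1 _ hb P _
          · rw [sub_zero, abs_zero]; exact restWgt_nonneg _ _ _ _
        unfold densG
        exact mul_le_mul (hΦb _) (mul_le_mul_of_nonneg_left hcd (densG_nonneg T D η))
          (mul_nonneg (densG_nonneg T D η) (abs_nonneg _)) hM0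
    have hrest := integral_densities_mul_restWgt_le hT hDP hDQ hPQ hcov
    have hcf := norm_cellCoef_le hT D
    -- the case `Dᶜ = ∅`
    rcases Nat.eq_zero_or_pos (Finset.univ \ D).card with hS0 | hSpos
    · have hP0 : P = ∅ := Finset.card_eq_zero.1 (by omega)
      have hQ0 : (Finset.univ \ D) \ P = ∅ := Finset.card_eq_zero.1 (by omega)
      rw [hQ0] at hdiff
      rw [hP0] at hdiff ⊢
      simp only [restWgt_empty, mul_zero, integral_zero] at hdiff
      have : ‖∫ η : Fin k → ℝ, (Φ (slicePt η) * ((densG T D η * cellDiag T D ∅ η : ℝ) : ℂ) -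
          Φ (slicePt η) * ((densG T D η * cellPair T D ∅ η : ℝ) : ℂ))‖ = 0 := le_antisymm hdiff (norm_nonneg _)
      rw [this, mul_zero]
      exact hX0
    -- the main case
    have hexp1 : D.card + (P.card + ((Finset.univ \ D) \ P).card - 1) = k := by omega
    have hp1 := pow_count_bad hT hexp1 hcardD
    have hI0 : 0 ≤ ∫ η : Fin k → ℝ, densG T D η * restWgt T (freq T (slicePt η)) P ((Finset.univ \ D) \ P) :=
      integral_nonneg fun η ↦ mul_nonneg (densG_nonneg T D η) (restWgt_nonneg _ _ _ _)
    set r := P.card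
    set s := ((Finset.univ \ D) \ P).card
    have hite : (5 * Real.log T) ^ D.card / Real.log T ^ k *
        (if 2 ≤ r ∧ s = r then coincConst k * Real.log T ^ (2 * r - 2) else 0) ≤ 5 ^ (k + 1) * coincConst k := by
      split_ifs with hc
      · have hexp2 : D.card + (2 * r - 2) ≤ k := by omega
        have := pow_count_coinc hT hexp2 hcardD
        calc _ = (5 * Real.log T) ^ D.card / Real.log T ^ k * Real.log T ^ (2 * r - 2) * coincConst k := by ring
          _ ≤ 5 ^ (k + 1) * coincConst k := mul_le_mul_of_nonneg_right this hco0
      · rw [mul_zero]; positivity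
    have hfin : T * (5 * Real.log T) ^ D.card * (MΦ * (densConst k / Real.log T ^ k *
        (badConst k * Real.log T ^ (r + s - 1) + (if 2 ≤ r ∧ s = r then coincConst k * Real.log T ^ (2 * r - 2) else 0)))) ≤ X := by
      have e : T * (5 * Real.log T) ^ D.card * (MΦ * (densConst k / Real.log T ^ k *
          (badConst k * Real.log T ^ (r + s - 1) + (if 2 ≤ r ∧ s = r then coincConst k * Real.log T ^ (2 * r - 2) else 0)))) =
          MΦ * T * (densConst k * ((5 * Real.log T) ^ D.card / Real.log T ^ k * Real.log T ^ (r + s - 1) * badConst k +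
            (5 * Real.log T) ^ D.card / Real.log T ^ k *
              (if 2 ≤ r ∧ s = r then coincConst k * Real.log T ^ (2 * r - 2) else 0))) := by ring
      rw [e]
      have hAB : (5 * Real.log T) ^ D.card / Real.log T ^ k * Real.log T ^ (r + s - 1) * badConst k +
          (5 * Real.log T) ^ D.card / Real.log T ^ k *
            (if 2 ≤ r ∧ s = r then coincConst k * Real.log T ^ (2 * r - 2) else 0) ≤
          5 ^ (k + 1) * (badConst k + coincConst k) := by
        have := mul_le_mul_of_nonneg_right hp1 hbad0
        linarith
      calc MΦ * T * (densConst k * ((5 * Real.log T) ^ D.card / Real.log T ^ k * Real.log T ^ (r + s - 1) * badConst k +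
            (5 * Real.log T) ^ D.card / Real.log T ^ k *
              (if 2 ≤ r ∧ s = r then coincConst k * Real.log T ^ (2 * r - 2) else 0)))
          ≤ MΦ * T * (densConst k * (5 ^ (k + 1) * (badConst k + coincConst k))) :=
            mul_le_mul_of_nonneg_left (mul_le_mul_of_nonneg_left hAB hdc) (by positivity)
        _ = X := by simp only [X]; ring
    calc ‖cellCoef T D‖ * ‖∫ η : Fin k → ℝ, (Φ (slicePt η) * ((densG T D η * cellDiag T D P η : ℝ) : ℂ) -
          Φ (slicePt η) * ((densG T D η * cellPair T D P η : ℝ) : ℂ))‖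
        ≤ (T * (5 * Real.log T) ^ D.card) * (MΦ * ∫ η : Fin k → ℝ, densG T D η *
            restWgt T (freq T (slicePt η)) P ((Finset.univ \ D) \ P)) :=
          mul_le_mul hcf hdiff (norm_nonneg _) (by positivity)
      _ ≤ (T * (5 * Real.log T) ^ D.card) * (MΦ * (densConst k / Real.log T ^ k *
            (badConst k * Real.log T ^ (r + s - 1) +
              (if 2 ≤ r ∧ s = r then coincConst k * Real.log T ^ (2 * r - 2) else 0)))) :=
          mul_le_mul_of_nonneg_left (mul_le_mul_of_nonneg_left hrest hM0) (by positivity)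
      _ ≤ X := hfin
  -- sum over the cells
  refine (norm_sum_le _ _).trans ?_
  calc ∑ D ∈ (Finset.univ : Finset (Fin (k + 1))).powerset, ‖∑ P ∈ (Finset.univ \ D).powerset,
        cellCoef T D * ((∫ η : Fin k → ℝ, Φ (slicePt η) * ((densG T D η * cellDiag T D P η : ℝ) : ℂ)) -
          ∫ η : Fin k → ℝ, Φ (slicePt η) * ((densG T D η * cellPair T D P η : ℝ) : ℂ))‖
      ≤ ∑ D ∈ (Finset.univ : Finset (Fin (k + 1))).powerset, 2 ^ (k + 1) * X := by
        refine Finset.sum_le_sum fun D hD ↦ (norm_sum_le _ _).trans ?_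
        refine (Finset.sum_le_sum (hcell D hD)).trans ?_
        rw [Finset.sum_const, nsmul_eq_mul, Finset.card_powerset]
        refine mul_le_mul_of_nonneg_right ?_ hX0
        have : (Finset.univ \ D).card ≤ k + 1 := by have := (Finset.univ \ D).card_le_univ; rwa [Fintype.card_fin] at this
        exact_mod_cast Nat.pow_le_pow_right (by norm_num) this
    _ = mainErrConst k * MΦ * T := by
        rw [Finset.sum_const, Finset.card_powerset, Finset.card_univ, Fintype.card_fin, nsmul_eq_mul]
        simp only [X, mainErrConst]
        rw [show (4 : ℝ) ^ (k + 1) = 2 ^ (k + 1) * 2 ^ (k + 1) by rw [← mul_pow]; norm_num]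
        push_cast
        ring

open scoped Classical in
/-- **Uniform bound** (for the a priori estimates): under the same hypotheses,
`‖∫_η Φ(ξ(η)) 𝔓_T(ξ(η)) dη‖ ≤ C'(n) M_Φ T log T`. [cite: RudnickSarnak1996, (3.49)] -/
theorem norm_integral_patternSum_le {T : ℝ} (hT : 3 ≤ T) {Φ : (Fin (k + 1) → ℝ) → ℂ} {MΦ : ℝ}
    (hΦi : Integrable fun η : Fin k → ℝ ↦ Φ (slicePt η)) (hΦb : ∀ ξ, ‖Φ ξ‖ ≤ MΦ)
    (hΦs : ∀ ξ, Φ ξ ≠ 0 → ∀ j, |ξ j| ≤ 2) :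
    ‖∫ η : Fin k → ℝ, Φ (slicePt η) * patternSum T (slicePt η)‖ ≤ unifConst k * MΦ * T * Real.log T := by
  have hT1 : (1 : ℝ) ≤ T := by linarith
  have hT0 : (0 : ℝ) ≤ T := by linarith
  have hL := one_le_log hT
  have hM0 : 0 ≤ MΦ := (norm_nonneg _).trans (hΦb 0)
  have hdc := (densConst_pos k).le
  have hintF := integrable_phi_cellDiag hΦi T
  rw [integral_phi_mul_patternSum_eq hΦi T]
  set Y : ℝ := MΦ * T * Real.log T * (densConst k * 5 ^ (k + 1) * ((3 * (k + 1)) ^ (k + 1) * 9 ^ (k + 1)))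
  have hY0 : 0 ≤ Y := by positivity
  have hcell : ∀ D ∈ (Finset.univ : Finset (Fin (k + 1))).powerset, ∀ P ∈ (Finset.univ \ D).powerset,
      ‖cellCoef T D * ∫ η : Fin k → ℝ, Φ (slicePt η) * ((densG T D η * cellDiag T D P η : ℝ) : ℂ)‖ ≤ Y := by
    intro D _ P hP
    rw [Finset.mem_powerset] at hP
    set Q := (Finset.univ \ D) \ P
    obtain ⟨hDP, hDQ, hPQ, hcov⟩ := cell_disjoint D P hP
    have hcardS : D.card + (Finset.univ \ D).card = k + 1 := card_add_card_sdiff D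
    have hcardPQ : P.card + Q.card = (Finset.univ \ D).card := card_add_card_sdiff' hP
    have hcardD : D.card ≤ k + 1 := by omega
    have hr : P.card ≤ k + 1 := by omega
    have hs : Q.card ≤ k + 1 := by omega
    set eP : Fin P.card ≃ P := P.equivFin.symm
    set eQ : Fin Q.card ≃ Q := Q.equivFin.symm
    set fullW : (Fin k → ℝ) → ℝ := fun η ↦ ∑ ν ∈ tuples P.card (primeBound T), ∑ μ ∈ tuples Q.card (primeBound T),
      (if ∏ i, ν i = ∏ j, μ j then wgt (freq T (slicePt η)) (fun i ↦ (eP i : Fin (k + 1))) (fun j ↦ (eQ j : Fin (k + 1))) ν μ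
        else 0)
    have hfullW0 : ∀ η, 0 ≤ fullW η := fun η ↦ Finset.sum_nonneg fun ν _ ↦ Finset.sum_nonneg fun μ _ ↦ by
      split_ifs
      · exact wgt_nonneg _ _ _ _ _
      · exact le_rfl
    have hwi := integrable_densities_mul_wgt hT hDP hDQ hPQ hcov eP eQ
    have hIW : Integrable fun η : Fin k → ℝ ↦ densG T D η * fullW η := by
      simp only [fullW, densG, Finset.mul_sum]
      refine integrable_finsetSum _ fun ν _ ↦ integrable_finsetSum _ fun μ _ ↦ ?_
      by_cases hc : ∏ i, ν i = ∏ j, μ j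
      · simp only [if_pos hc]; exact hwi ν μ
      · simp only [if_neg hc, mul_zero]; exact integrable_zero _ _ _
    -- the integral bound
    have hdiff : ‖∫ η : Fin k → ℝ, Φ (slicePt η) * ((densG T D η * cellDiag T D P η : ℝ) : ℂ)‖ ≤
        MΦ * ∫ η : Fin k → ℝ, densG T D η * fullW η := by
      rw [← integral_const_mul]
      refine (norm_integral_le_integral_norm _).trans (integral_mono (hintF D P).norm (hIW.const_mul MΦ) fun η ↦ ?_)
      dsimp only
      rw [norm_mul, Complex.norm_real, Real.norm_eq_abs, abs_mul, abs_of_nonneg (densG_nonneg T D η)]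
      by_cases hΦ0 : Φ (slicePt η) = 0
      · rw [hΦ0, norm_zero, zero_mul]
        exact mul_nonneg hM0 (mul_nonneg (densG_nonneg T D η) (hfullW0 η))
      · have hbox := hΦs _ hΦ0
        have hb : ∀ j, freq T (slicePt η) j ≤ 2 * Real.log T := freq_le_of_box hT1 hbox
        have hcd : |cellDiag T D P η| ≤ fullW η := by
          unfold cellDiag
          split_ifs
          · rw [abs_of_nonneg (sideDiag_nonneg _ _ _ _)]
            unfold sideDiag
            rw [sum_coefProd_mul_eq hT1 _ hb P Q hr eP eQ]
          · rw [abs_zero]; exact hfullW0 η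
        exact mul_le_mul (hΦb _) (mul_le_mul_of_nonneg_left hcd (densG_nonneg T D η))
          (mul_nonneg (densG_nonneg T D η) (abs_nonneg _)) hM0
    have hfull := integral_densities_mul_sum_ite_le hT hDP hDQ hPQ hcov eP eQ
      ((tuples P.card (primeBound T)) ×ˢ (tuples Q.card (primeBound T)))
      (fun x ↦ ∏ i, x.1 i = ∏ j, x.2 j) (fun x ↦ x.1) (fun x ↦ x.2)
    simp only [Finset.sum_product] at hfull
    have hfull' : ∫ η : Fin k → ℝ, densG T D η * fullW η ≤
        densConst k / Real.log T ^ k * ((3 * (k + 1)) ^ (k + 1) * 9 ^ (k + 1) * Real.log T ^ (P.card + Q.card)) := by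
      refine hfull.trans (mul_le_mul_of_nonneg_left (sum_cfgWeight_le_pow hT hr hs) ?_)
      exact div_nonneg hdc (by positivity)
    have hcf := norm_cellCoef_le hT D
    have hexp : D.card + (P.card + Q.card) = k + 1 := by omega
    have hpow := pow_count_unif hT hexp
    have h5 : (5 : ℝ) ^ D.card ≤ 5 ^ (k + 1) := pow_le_pow_right₀ (by norm_num) hcardD
    rw [norm_mul]
    calc ‖cellCoef T D‖ * ‖∫ η : Fin k → ℝ, Φ (slicePt η) * ((densG T D η * cellDiag T D P η : ℝ) : ℂ)‖
        ≤ (T * (5 * Real.log T) ^ D.card) * (MΦ * (densConst k / Real.log T ^ k *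
            ((3 * (k + 1)) ^ (k + 1) * 9 ^ (k + 1) * Real.log T ^ (P.card + Q.card)))) :=
          mul_le_mul hcf (hdiff.trans (mul_le_mul_of_nonneg_left hfull' hM0)) (norm_nonneg _) (by positivity)
      _ = MΦ * T * (densConst k * ((3 * (k + 1)) ^ (k + 1) * 9 ^ (k + 1)) *
            ((5 * Real.log T) ^ D.card / Real.log T ^ k * Real.log T ^ (P.card + Q.card))) := by ring
      _ = MΦ * T * (densConst k * ((3 * (k + 1)) ^ (k + 1) * 9 ^ (k + 1)) * (5 ^ D.card * Real.log T)) := by rw [hpow]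
      _ ≤ MΦ * T * (densConst k * ((3 * (k + 1)) ^ (k + 1) * 9 ^ (k + 1)) * (5 ^ (k + 1) * Real.log T)) := by
          refine mul_le_mul_of_nonneg_left (mul_le_mul_of_nonneg_left (mul_le_mul_of_nonneg_right h5 (by linarith))
            (by positivity)) (by positivity)
      _ = Y := by simp only [Y]; ring
  refine (norm_sum_le _ _).trans ?_
  calc ∑ D ∈ (Finset.univ : Finset (Fin (k + 1))).powerset, ‖∑ P ∈ (Finset.univ \ D).powerset,
        cellCoef T D * ∫ η : Fin k → ℝ, Φ (slicePt η) * ((densG T D η * cellDiag T D P η : ℝ) : ℂ)‖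
      ≤ ∑ D ∈ (Finset.univ : Finset (Fin (k + 1))).powerset, 2 ^ (k + 1) * Y := by
        refine Finset.sum_le_sum fun D hD ↦ (norm_sum_le _ _).trans ?_
        refine (Finset.sum_le_sum (hcell D hD)).trans ?_
        rw [Finset.sum_const, nsmul_eq_mul, Finset.card_powerset]
        refine mul_le_mul_of_nonneg_right ?_ hY0
        have : (Finset.univ \ D).card ≤ k + 1 := by have := (Finset.univ \ D).card_le_univ; rwa [Fintype.card_fin] at this
        exact_mod_cast Nat.pow_le_pow_right (by norm_num) this
    _ = unifConst k * MΦ * T * Real.log T := by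
        rw [Finset.sum_const, Finset.card_powerset, Finset.card_univ, Fintype.card_fin, nsmul_eq_mul]
        simp only [Y, unifConst]
        rw [show (4 : ℝ) ^ (k + 1) = 2 ^ (k + 1) * 2 ^ (k + 1) by rw [← mul_pow]; norm_num]
        push_cast
        ring

end RudnickSarnakN

end Literature.NumberTheory.LFunctions

end
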